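import Literature.NumberTheory.ConnesConsani2025.ZetaSpectralTriplesWeilForm
import Literature.NumberTheory.LFunctions.WeilWindowSimpleEven
import Literature.NumberTheory.LFunctions.WeilGroundStateRealZerosProofs
import Literature.NumberTheory.LFunctions.WeilExplicitProofs
import Literature.Analysis.UnboundedOperators.ClosedFormSpectrum
import Literature.Analysis.OperatorTheory.CompactEmbeddingFormSpectrum
import Mathlib.Analysis.Normed.Lp.SmoothApprox
import HarnessLib

/-!
# Connes–Consani–Moscovici, *Zeta spectral triples*, §3.2 eq. (3.23): the self-adjoint operator `A_λ`
# of the semilocal Weil quadratic form `QW_λ`, and its spectrum (Prop. 3.5, Thm. 3.6, Cor. 3.7) — OPERATOR LAYER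

LINE 1 — LABEL: **RH-FREE corpus literature.** This file realises the lower-bounded, lower
semicontinuous quadratic form `QW_λ` on the window `[λ⁻¹, λ]` by a self-adjoint operator and records
the printed spectral consequences (compact resolvent, orthonormal eigenbasis, bottom eigenvalue).  No
statement here is a positivity statement: the SIGN of the bottom `μ_λ = ε(a) = weilGroundEnergy a` is
untouched (`0 ≤ ε(a)` for all `a` IS RH, `UniformWeilPositivityRH.lean`).  Cell `rh-crit`, sub-cell `cc/`,
row t15 FILE B, written by seat cc-t5 g6; bears_on W-C/W-P as SEQUEL TYPING (CCM 2025 §3 plumbing, GAP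
G-cc-14 / [lead G-cc-8] "(3.23) `A_λ` form ↔ operator needs a Friedrichs-extension API" — the API is
`Literature/Analysis/UnboundedOperators/{ClosedFormOperator, ClosableForm, ClosedFormSpectrum}.lean`).
WHAT THIS IS NOT: a claim about RH, a new conjecture, a route; nothing here bears on the truth of RH.

Source: A. Connes, C. Consani, H. Moscovici, *Zeta spectral triples*, arXiv:2511.22755v1 (2025), §3.1–§3.2,
printed pp. 8–11 (= PDF pp. 10–13 of the materialised text `paper:arxiv-2511.22755`) [bib
`ConnesConsaniMoscovici2025`]; EMS Ser. Lect. Math. 37 (2026) 39–76.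

## What the source prints (pp. 8–11) and what is constructed here

* p. 8, Prop. 3.3 ([4, §2]): "`QW_λ` is lower bounded and lower semi-continuous" — in the tree:
  `bddBelow_weilQuadratic_sphere_holds` and `ConnesConsaniMoscovici2025_prop_3_3_holds` (PROVED; cited,
  not restated).  Here: the sequential lsc is turned into Kato's closability criterion
  (`WeilCore.norm_le_of_tendsto`, `WeilCore.formEmbedding_toL2_injective`).
* p. 9, "[12, Prop. 10.1] (1)–(4) … By Proposition 3.3 the condition (3) is fulfilled … Theorem 10.7 in
  [12] (representation theorem for semibounded forms) applies.  Thus, for each `λ > 1`, there is a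
  canonical lower bounded unbounded selfadjoint operator `A_λ` in the Hilbert space `L²([λ⁻¹, λ], d*u)`
  such that `QW_λ(f, f) = ⟨A_λ f | f⟩` (3.23).  By construction … `A_λ` is lower bounded."  Here:
  `weilOperator a` (DEFINITION, via Kato's first representation theorem `formOperator` of the tree),
  `WeilOperator.isSelfAdjoint`, `WeilOperator.lowerBound` (`Re ⟪A_λ u, u⟫ ≥ ε(a)‖u‖²`),
  `WeilOperator.inner_apply_toL2` / `…_self` ((3.23) on the core: `⟪A_λ f, g⟫ = QW_λ(f, g) = Ψ(f* ∗ g)`,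
  `⟪A_λ f, f⟫ = Q(f)`), `WeilOperator.exists_form_eq` ((3.23) on the whole domain, with the CLOSED form),
  `WeilOperator.eq_of_isSelfAdjoint_of_represents` ("canonical": Kato's uniqueness).
* p. 9, Prop. 3.5 ([12, Prop. 10.6]: (1) compact form-domain embedding ⇔ (2) compact resolvent ⇔ (3)
  `(A − mI)^{−1/2}` compact ⇔ (4) purely discrete spectrum) and Thm. 3.6 "The selfadjoint operator `A_λ`
  has discrete lower bounded spectrum" — in the tree the sequential content of (1) is
  `ConnesConsaniMoscovici2025_thm_3_6_holds` (PROVED).  Here, for `A_λ` itself: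
  (1) `WeilOperator.isCompactOperator_formEmbedding`, (2) `WeilOperator.isCompactOperator_resolvent`,
  (4) `WeilOperator.exists_hilbertBasis_eigenvectors` (Hilbert basis of `L²([−a, a])` of eigenvectors,
  eigenvalues `μ_i ≥ ε(a)`, `μ_i → +∞` cofinitely) and its `ℕ`-indexed form
  `WeilOperator.exists_hilbertBasis_nat_eigenvectors` (`μ₀, μ₁, … → +∞`; `L²([−a, a])` is
  infinite-dimensional, `WeilOperator.not_finiteDimensional`).  NOT typed: (3) (no functional calculus
  for unbounded operators in the tree) — `-- TODO(general form)`.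
* p. 11, Cor. 3.7 "there exists `φ ∈ L²([λ⁻¹, λ], d*u)` such that `A_λ φ = μ_λ φ` where `μ_λ` is the
  largest lower bound of the spectrum of `A_λ`" — here `WeilOperator.exists_eigenvector_weilGroundEnergy`
  (with `lowerBound`: the largest lower bound is `ε(a) = weilGroundEnergy a`, the infimum of `Re Q` on the
  unit sphere of the core, i.e. the tree's `μ_λ` of `ZetaSpectralTriplesWeilForm.lean`'s dictionary), and
  the CONSISTENCY with the tree's operator-free ground states: for `IsWeilGroundState a u` (the
  `L²`-limit of a normalised minimising sequence of window test functions, `WeilGroundState.lean`) the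
  restriction `u|[−a, a]` is a unit vector of `dom A_λ` with `A_λ u = ε(a) u`
  (`WeilOperator.apply_eq_smul_of_isWeilGroundState`, `.exists_eigenvector_of_isWeilGroundState`), and
  conversely every unit `φ ∈ dom A_λ` with `A_λ φ = ε(a) φ` is (on the window, extended by `0`) such a
  ground state (`WeilOperator.exists_isWeilGroundState_of_apply_eq_smul`): the ground states are exactly
  the unit vectors of the bottom eigenspace of `A_λ`.

## Dictionary and construction (the tree's additive normalisation; NO parallel vocabulary)

`λ > 1`, `a = log λ > 0`, `u = e^t`: `L²([λ⁻¹, λ], d*u) = L²([−a, a], dt)` ↦ `WindowL2 a :=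
Lp ℂ 2 (volume.restrict (Icc (−a) a))`.  The form core ↦ `weilCoreSubmodule a` = window test functions
`{g | IsWeilTest g ∧ tsupport g ⊆ Icc (−a) a}` (the standing identification of `QW_λ`'s domain in
`WeilSemilocalCompactness.lean`; it contains the printed core `E = span{V_n}` only after smoothing — the
paper's `V_n` are discontinuous at the end points — and is a form core by Prop. 3.4 / density), carried by
the type synonym `WeilCore a` with the form inner product
`⟪f, g⟫_V := QW_λ(f, g) + (1 − ε(a)) ⟪f, g⟫_{L²}` (`QW_λ(f, g) = weilSesqForm f g = Ψ(f* ∗ g)` of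
`ZetaSpectralTriplesWeilForm.lean`, antilinear in `f`; `ε(a) = weilGroundEnergy a`), so that
`‖f‖_V² = Re Q(f) + (1 − ε(a))‖f‖₂² ≥ ‖f‖₂²` (`WeilCore.norm_sq_eq`; `Re Q(f) ≥ ε(a)‖f‖₂²` is the tree's
`ConnesVanSuijlekom.weilGroundEnergy_mul_le_re`).  In the `(Q, J)` format of `ClosedFormOperator.lean`:
`Q_a := UniformSpace.Completion (WeilCore a)`, `J_a := formEmbedding (WeilCore.toL2 a)` (injective by
Prop. 3.3, dense range by density of window test functions in `L²([−a, a])`, COMPACT by Thm. 3.6), the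
form `‖x‖_Q² − ‖J x‖²` is the closure of `Re QW_λ − ε(a)‖·‖²`, and
`weilOperator a := formOperator J_a + ε(a) = shiftPMap (formOperator J_a) (−ε(a))`.

## Design notes

* No `instance` is declared (typer lint rule): the algebraic / normed / inner-product structures of the
  core are explicit `abbrev`s (`WeilCore.addCommGroup`, `.module`, `.normedAddCommGroup`,
  `.innerProductSpace`, fed by `InnerProductSpace.Core` = `WeilCore.ipCore`) and are brought into scope
  with `letI` inside statements and proofs; `WeilCore a` is a TYPE SYNONYM of `↥(weilCoreSubmodule a)` so
  that it carries no topology but the form norm.  All public conclusions about `weilOperator a` are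
  stated on `WindowL2 a` and need no instance.
* Generic lemmas proved here because the tree lacks them (abstract Hilbert-space facts, [folklore] /
  Kato / Reed–Simon): `exists_tendsto_subseq_of_normalised`, `isCompactOperator_formEmbedding_of_seq`
  (sequential compactness on a core ⟹ compact form-domain embedding), `shiftPMap` (+ `isSelfAdjoint_shiftPMap`,
  `resolvent_shiftPMap`, `shiftPMap_shiftPMap_neg`), `norm_formEmbedding_le_norm`, `re_inner_real_smul_self`.
* Hypotheses: the theorems assume `0 < a` (`λ > 1`); for `a ≤ 0` the objects are junk.

## Table: printed item → declaration → status

| printed item (arXiv v1 page) | declaration | status |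
|---|---|---|
| §3.1 p. 8, `QW_λ` on `L²([λ⁻¹, λ], d*u)`, its core | `windowMeasure`, `WindowL2`, `weilCoreSubmodule`, `WeilCore`, `WeilCore.toL2` | defs |
| §3.1 p. 8, sesquilinear form of `QW_λ` | `conj_weilSesqForm`, `weilSesqForm_add_left/right`, `weilSesqForm_const_mul_left`, `WeilCore.ip`, `WeilCore.ipCore` | PROVED / defs |
| §3.1 Prop. 3.3 p. 8 (lsc ⟹ closable) | `WeilCore.norm_le_of_tendsto`, `WeilCore.formEmbedding_toL2_injective` | PROVED (from `…prop_3_3_holds`) |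
| core dense in `L²([λ⁻¹, λ])` | `WeilCore.denseRange_toL2`, `WeilCore.denseRange_formEmbedding_toL2` | PROVED |
| §3.2 (3.23) p. 9, `A_λ` | `weilOperator`, `WeilOperator.isSelfAdjoint`, `.dense_domain`, `.lowerBound`, `.inner_apply_toL2(_self)`, `.exists_form_eq`, `.eq_of_isSelfAdjoint_of_represents` | def + PROVED |
| §3.2 Prop. 3.5 (1), (2) p. 9 | `WeilOperator.isCompactOperator_formEmbedding`, `.isCompactOperator_resolvent` | PROVED (from `…thm_3_6_holds`) |
| §3.2 Thm. 3.6 p. 9 | `WeilOperator.exists_hilbertBasis_eigenvectors`, `.not_finiteDimensional`, `.exists_hilbertBasis_nat_eigenvectors` | PROVED |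
| §3.2 Cor. 3.7 p. 11 | `WeilOperator.exists_eigenvector_weilGroundEnergy` | PROVED |
| Cor. 3.7 ↔ the tree's operator-free ground states (`IsWeilGroundState`) | `WeilOperator.apply_eq_smul_of_isWeilGroundState`, `.norm_toLp_of_isWeilGroundState`, `.exists_eigenvector_of_isWeilGroundState`, converse `.exists_isWeilGroundState_of_apply_eq_smul` | PROVED |
| Prop. 3.5 (3) `(A − mI)^{−1/2}` compact | — | NOT typed (`-- TODO(general form)`) |

## References
* A. Connes, C. Consani, H. Moscovici, *Zeta spectral triples*, arXiv:2511.22755 (2025), §3.1 Prop. 3.3,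
  Prop. 3.4, §3.2 eq. (3.23), Prop. 3.5, Thm. 3.6, Cor. 3.7. [ConnesConsaniMoscovici2025]
* A. Connes, C. Consani, *Spectral triples and ζ-cycles*, Enseign. Math. 69 (2023), §2.1 Prop. 2.1 (= [4]
  of the source, origin of Prop. 3.3). [ConnesConsani2023]
* T. Kato, *Perturbation Theory for Linear Operators* (1966), VI §1.3 (`H_𝔥`), §1.4 Thms 1.16–1.17
  (closable forms), §2.1 Thm 2.1, Cor 2.4, Thm 2.6 and §2.2 (first representation theorem), held text
  `book-kato1966-perturbation-theory-linear-operators` p0369–p0381. [Kato1966]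
* K. Schmüdgen, *Unbounded self-adjoint operators on Hilbert space*, GTM 265 (2012), Prop. 10.1, 10.6,
  Thm. 10.7 (= [12] of the source). [Schmudgen2012]
* M. Reed, B. Simon, *Methods of Modern Mathematical Physics* I (1980) Thm VIII.3, IV (1978) Thm XIII.64.
  [ReedSimonI1980] [ReedSimonIV1978]
-/

-- TODO(general form): Prop. 3.5 (3) (`(A_λ − mI)^{−1/2}` compact) once an unbounded functional calculus
-- is in the tree; a monotone (`μ₀ ≤ μ₁ ≤ …`) enumeration of the eigenvalues with multiplicity.

noncomputable section

open Complex Filter Set MeasureTheory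
open scoped Real Topology ComplexConjugate InnerProductSpace ContDiff

namespace Literature.NumberTheory.ConnesConsani2025

open Literature.NumberTheory.LFunctions Literature.Analysis.UnboundedOperators
open _root_.MeasureTheory

/-! ## The window core -/

/-- **The form core of `QW_λ` on the window**: the `ℂ`-submodule of smooth compactly supported test
functions `g` (`IsWeilTest g`) with `tsupport g ⊆ [−a, a]`, `a = log λ` — the functions on which
`QW_λ(g, g) = weilQuadratic g` is the tree's semilocal Weil form (`WeilSemilocalCompactness.lean`,
`ZetaSpectralTriplesWeilForm.lean` dictionary). [cite: ConnesConsaniMoscovici2025, §3.1 p. 8 (`QW_λ` = restriction of `QW` to `L²([λ⁻¹, λ], d*u)`)] -/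
def weilCoreSubmodule (a : ℝ) : Submodule ℂ (ℝ → ℂ) where
  carrier := {g | IsWeilTest g ∧ tsupport g ⊆ Icc (-a) a}
  add_mem' := by
    rintro f g ⟨hf, hfs⟩ ⟨hg, hgs⟩
    refine ⟨hf.add hg, closure_minimal ((Function.support_add f g).trans ?_) isClosed_Icc⟩
    exact union_subset ((subset_tsupport f).trans hfs) ((subset_tsupport g).trans hgs)
  zero_mem' := ⟨⟨contDiff_const, HasCompactSupport.zero⟩, by simp [tsupport_zero]⟩
  smul_mem' := by
    rintro c g ⟨hg, hgs⟩
    refine ⟨?_, (tsupport_smul_subset_right (fun _ : ℝ => c) g).trans hgs⟩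
    have h := hg.const_mul c
    simp_rw [← smul_eq_mul] at h
    exact h

/-- Membership in the window core, unfolded. [cite: ConnesConsaniMoscovici2025, §3.1 p. 8 (the domain of `QW_λ`: functions on the window `[λ⁻¹, λ]`)] -/
theorem mem_weilCoreSubmodule {a : ℝ} {g : ℝ → ℂ} :
    g ∈ weilCoreSubmodule a ↔ IsWeilTest g ∧ tsupport g ⊆ Icc (-a) a := Iff.rfl

/-- **The core as a TYPE** (`V_a`): a type synonym of `↥(weilCoreSubmodule a)`, so that it carries no
topology or norm other than the FORM norm put on it below (Kato's pre-Hilbert space `H_𝔥` built on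
the form domain). [cite: ConnesConsaniMoscovici2025, §3.1 p. 8; Kato1966, VI §1.3 (the pre-Hilbert space `H_𝔥` on `D(𝔥)`), held p0369] -/
def WeilCore (a : ℝ) : Type := ↥(weilCoreSubmodule a)

namespace WeilCore

variable {a : ℝ}

/-- The underlying function `ℝ → ℂ` of a core element. [folklore] -/
def val (f : WeilCore a) : ℝ → ℂ := (show ↥(weilCoreSubmodule a) from f : ℝ → ℂ)

/-- A core element is a test function. [cite: ConnesConsaniMoscovici2025, §3.1 p. 8 (the domain of `QW_λ`: functions on the window `[λ⁻¹, λ]`)] -/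
theorem isWeilTest (f : WeilCore a) : IsWeilTest f.val := (show ↥(weilCoreSubmodule a) from f).2.1

/-- A core element is supported in the window `[−a, a]`. [cite: ConnesConsaniMoscovici2025, §3.1 p. 8 (the domain of `QW_λ`: functions on the window `[λ⁻¹, λ]`)] -/
theorem tsupport_subset (f : WeilCore a) : tsupport f.val ⊆ Icc (-a) a :=
  (show ↥(weilCoreSubmodule a) from f).2.2

/-- A window test function as a core element. [folklore] -/
def mk (g : ℝ → ℂ) (hg : IsWeilTest g) (hgs : tsupport g ⊆ Icc (-a) a) : WeilCore a :=
  (⟨g, hg, hgs⟩ : ↥(weilCoreSubmodule a))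

/-- `(mk g _ _).val = g`. [cite: ConnesConsaniMoscovici2025, §3.1 p. 8 (the domain of `QW_λ`: functions on the window `[λ⁻¹, λ]`)] -/
theorem val_mk (g : ℝ → ℂ) (hg : IsWeilTest g) (hgs : tsupport g ⊆ Icc (-a) a) :
    (mk g hg hgs : WeilCore a).val = g := rfl

/-- The additive group structure of the core (that of the submodule; an explicit `abbrev`, no instance
is declared in this file). [folklore] -/
abbrev addCommGroup (a : ℝ) : AddCommGroup (WeilCore a) :=
  inferInstanceAs (AddCommGroup ↥(weilCoreSubmodule a))

/-- The `ℂ`-module structure of the core (that of the submodule; explicit `abbrev`). [folklore] -/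
abbrev module (a : ℝ) : @Module ℂ (WeilCore a) _ (addCommGroup a).toAddCommMonoid :=
  inferInstanceAs (Module ℂ ↥(weilCoreSubmodule a))

/-- `(f + g).val = f.val + g.val`. [cite: ConnesConsaniMoscovici2025, §3.1 p. 8 (the domain of `QW_λ`: functions on the window `[λ⁻¹, λ]`)] -/
theorem val_add (f g : WeilCore a) :
    letI := addCommGroup a
    (f + g).val = f.val + g.val := rfl

/-- `(c • f).val = c · f.val`. [cite: ConnesConsaniMoscovici2025, §3.1 p. 8 (the domain of `QW_λ`: functions on the window `[λ⁻¹, λ]`)] -/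
theorem val_smul (c : ℂ) (f : WeilCore a) :
    letI := addCommGroup a; letI := module a
    (c • f).val = fun t => c * f.val t := rfl

/-- `(0 : V_a).val = 0`. [cite: ConnesConsaniMoscovici2025, §3.1 p. 8 (the domain of `QW_λ`: functions on the window `[λ⁻¹, λ]`)] -/
theorem val_zero : (letI := addCommGroup a; (0 : WeilCore a)).val = 0 := rfl

/-- A core element is determined by its underlying function. [cite: ConnesConsaniMoscovici2025, §3.1 p. 8 (the domain of `QW_λ`: functions on the window `[λ⁻¹, λ]`)] -/
theorem val_injective : Function.Injective (val : WeilCore a → ℝ → ℂ) :=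
  fun _ _ h => Subtype.ext h

end WeilCore


/-! ## Algebra of the Weil functional under `⋆` and `̃` (private copies; hypothesis-free) -/

section Algebra

/-- Commutativity of the additive convolution. [folklore] -/
private theorem weilConv_comm' (f g : ℝ → ℂ) : weilConv f g = weilConv g f := by
  have h := convolution_flip (L := ContinuousLinearMap.mul ℂ ℂ) (μ := (volume : Measure ℝ))
    (f := f) (g := g)
  rw [ContinuousLinearMap.flip_mul] at h
  exact h.symm

/-- `(g̃)̃ = g`. [folklore] -/
private theorem weilReflect_weilReflect' (g : ℝ → ℂ) : weilReflect (weilReflect g) = g := by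
  funext t
  simp [weilReflect]

/-- `(f ⋆ g)̃ = f̃ ⋆ g̃`. [folklore] -/
private theorem weilReflect_weilConv' (f g : ℝ → ℂ) :
    weilReflect (weilConv f g) = weilConv (weilReflect f) (weilReflect g) := by
  funext t
  simp only [weilReflect]
  rw [weilConv_apply, weilConv_apply, ← integral_conj,
    ← integral_neg_eq_self (fun u : ℝ ↦ conj (f u * g (-t - u))) volume]
  refine integral_congr_ae (Eventually.of_forall fun u ↦ ?_)
  simp only [map_mul]
  congr 2
  ring

/-- `conj W(k) = W(k̃)` (hypothesis-free). [cite: Bombieri2000Weil, §§2–3] -/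
private theorem conj_weilFunctional' (k : ℝ → ℂ) :
    conj (weilFunctional k) = weilFunctional (weilReflect k) := by
  have hM : ∀ s, weilMellin (weilReflect k) s = conj (weilMellin k (1 - conj s)) :=
    weilMellin_weilReflect_holds k
  have hP : conj (weilPolarTerm k) = weilPolarTerm (weilReflect k) := by
    rw [weilPolarTerm, weilPolarTerm, map_add, hM 0, hM 1, map_zero, sub_zero, map_one, sub_self,
      add_comm]
  have hΛ : conj (weilPrimeTerm k) = weilPrimeTerm (weilReflect k) := by
    rw [weilPrimeTerm, weilPrimeTerm, Complex.conj_tsum]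
    refine tsum_congr fun n ↦ ?_
    simp only [map_mul, map_div₀, Complex.conj_ofReal, map_add, weilReflect, neg_neg]
    ring
  have hhalf : ∀ t : ℝ, (1 : ℂ) - conj (1 / 2 + (t : ℂ) * I) = 1 / 2 + (t : ℂ) * I := fun t ↦ by
    apply Complex.ext <;> norm_num
  have hA : conj (weilArchTerm k) = weilArchTerm (weilReflect k) := by
    rw [weilArchTerm, weilArchTerm, map_sub, map_mul, map_mul, weilArchIntegral, weilArchIntegral,
      ← integral_conj]
    have h0 : weilReflect k 0 = conj (k 0) := by simp [weilReflect]
    rw [h0, Complex.conj_ofReal]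
    congr 2
    · rw [map_div₀, map_one, map_mul, map_ofNat, Complex.conj_ofReal]
    · refine integral_congr_ae (Eventually.of_forall fun t ↦ ?_)
      dsimp only
      rw [map_mul, Complex.conj_ofReal, hM, hhalf]
  rw [weilFunctional, weilFunctional, map_add, map_sub, hP, hΛ, hA]

variable {f f₁ f₂ g : ℝ → ℂ}

/-- `QW(f, g) = W(g ⋆ f̃)` on test functions (the paper's `Ψ(f* ∗ g)` with `Ψ = W` on test kernels and
`f̃ ⋆ g = g ⋆ f̃`). [cite: ConnesConsaniMoscovici2025, §3 eq. (3.10), p. 6] -/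
theorem weilSesqForm_eq_weilFunctional (hf : IsWeilTest f) (hg : IsWeilTest g) :
    weilSesqForm f g = weilFunctional (weilConv g (weilReflect f)) := by
  unfold weilSesqForm
  rw [psiFunctional_eq_weilFunctional (hf.weilReflect.weilConv hg), weilConv_comm']

/-- Hermitian symmetry `conj QW(g, f) = QW(f, g)` on test functions. [cite: ConnesConsaniMoscovici2025, §3.1 p. 8 («the associated sesquilinear form (antilinear in the first variable)»)] -/
theorem conj_weilSesqForm (hf : IsWeilTest f) (hg : IsWeilTest g) :
    conj (weilSesqForm g f) = weilSesqForm f g := by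
  rw [weilSesqForm_eq_weilFunctional hg hf, weilSesqForm_eq_weilFunctional hf hg, conj_weilFunctional',
    weilReflect_weilConv', weilReflect_weilReflect', weilConv_comm']

/-- Additivity in the first (antilinear) variable. [cite: ConnesConsaniMoscovici2025, §3.1 p. 8] -/
theorem weilSesqForm_add_left (hf₁ : IsWeilTest f₁) (hf₂ : IsWeilTest f₂) (hg : IsWeilTest g) :
    weilSesqForm (f₁ + f₂) g = weilSesqForm f₁ g + weilSesqForm f₂ g := by
  rw [weilSesqForm_eq_weilFunctional (hf₁.add hf₂) hg, weilSesqForm_eq_weilFunctional hf₁ hg,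
    weilSesqForm_eq_weilFunctional hf₂ hg, weilReflect_add,
    weilConv_add_right hg hf₁.weilReflect hf₂.weilReflect,
    weilFunctional_add (hg.weilConv hf₁.weilReflect) (hg.weilConv hf₂.weilReflect)]

/-- Antilinearity in the first variable. [cite: ConnesConsaniMoscovici2025, §3.1 p. 8] -/
theorem weilSesqForm_const_mul_left (c : ℂ) (hf : IsWeilTest f) (hg : IsWeilTest g) :
    weilSesqForm (fun t => c * f t) g = conj c * weilSesqForm f g := by
  rw [weilSesqForm_eq_weilFunctional (hf.const_mul c) hg, weilSesqForm_eq_weilFunctional hf hg,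
    weilReflect_const_mul, weilConv_const_mul_right, weilFunctional_const_mul]

/-- Additivity in the second (linear) variable. [cite: ConnesConsaniMoscovici2025, §3.1 p. 8] -/
theorem weilSesqForm_add_right (hf : IsWeilTest f) (hg₁ : IsWeilTest f₁) (hg₂ : IsWeilTest f₂) :
    weilSesqForm f (f₁ + f₂) = weilSesqForm f f₁ + weilSesqForm f f₂ := by
  rw [← conj_weilSesqForm hf (hg₁.add hg₂), weilSesqForm_add_left hg₁ hg₂ hf, map_add,
    conj_weilSesqForm hf hg₁, conj_weilSesqForm hf hg₂]

/-- The real part of the diagonal is `Re Q`, the imaginary part vanishes. [cite: ConnesConsaniMoscovici2025, §3 eq. (3.10), p. 6] -/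
theorem weilSesqForm_self_re (hf : IsWeilTest f) : (weilSesqForm f f).re = (weilQuadratic f).re := by
  rw [weilSesqForm_self hf]

end Algebra


/-! ## The form inner product on the core -/

namespace WeilCore

variable {a : ℝ}

/-- `t ↦ conj (f t) * g t` is integrable for test functions. [folklore] -/
private theorem integrable_conj_mul {f g : ℝ → ℂ} (hf : IsWeilTest f) (hg : IsWeilTest g) :
    Integrable fun t : ℝ ↦ conj (f t) * g t :=
  ((Complex.continuous_conj.comp hf.1.continuous).mul hg.1.continuous).integrable_of_hasCompactSupport
    hg.2.mul_left

/-- `∫ conj f · f = ∫ ‖f‖²` (as a complex number). [folklore] -/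
private theorem integral_conj_mul_self (f : ℝ → ℂ) :
    ∫ t, conj (f t) * f t = ((∫ t, ‖f t‖ ^ 2 : ℝ) : ℂ) := by
  rw [← integral_complex_ofReal]
  refine integral_congr_ae (Eventually.of_forall fun t ↦ ?_)
  simp only
  rw [Complex.conj_mul', Complex.ofReal_pow]

/-- The form pairing of the core: `⟪f, g⟫ := QW(f, g) + (1 − ε(a)) ⟪f, g⟫_{L²}` (antilinear in `f`). [cite: ConnesConsaniMoscovici2025, §3.1 p. 8 («the associated sesquilinear form (antilinear in the first variable)»); Kato1966, VI §1.3 eq. (1.29) (`(u, v)_𝔥 = (𝔥 + 1)[u, v]` for `𝔥 ≥ 0`), held p0369] -/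
def ip (f g : WeilCore a) : ℂ :=
  weilSesqForm f.val g.val + ((1 - weilGroundEnergy a : ℝ) : ℂ) * ∫ t, conj (f.val t) * g.val t

/-- Hermitian symmetry of the form pairing. [cite: Kato1966, VI §1.3 (`H_𝔥` is a pre-Hilbert space), held p0369] -/
theorem conj_ip (f g : WeilCore a) : conj (ip g f) = ip f g := by
  unfold ip
  simp only [map_add, map_mul, Complex.conj_ofReal]
  rw [conj_weilSesqForm f.isWeilTest g.isWeilTest, ← integral_conj]
  congr 2
  refine integral_congr_ae (Eventually.of_forall fun t ↦ ?_)
  simp only [map_mul, Complex.conj_conj]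
  ring

/-- `Re ⟪f, f⟫ = Re Q(f) + (1 − ε(a)) ∫ |f|²`. [cite: Kato1966, VI §1.3 eq. (1.30), held p0369] -/
theorem ip_self_re (f : WeilCore a) :
    (ip f f).re = (weilQuadratic f.val).re + (1 - weilGroundEnergy a) * ∫ t, ‖f.val t‖ ^ 2 := by
  unfold ip
  rw [Complex.add_re, weilSesqForm_self_re f.isWeilTest, integral_conj_mul_self,
    ← Complex.ofReal_mul, Complex.ofReal_re]

/-- `∫ |f|² ≤ Re ⟪f, f⟫` (since `Re Q(f) ≥ ε(a) ∫ |f|²`, `ConnesVanSuijlekom.weilGroundEnergy_mul_le_re`). [cite: Kato1966, VI §1.3 («`‖u‖ ≤ ‖u‖_𝔥`»), held p0369] -/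
theorem integral_norm_sq_le_ip_self_re (f : WeilCore a) : ∫ t, ‖f.val t‖ ^ 2 ≤ (ip f f).re := by
  rw [ip_self_re]
  have h := ConnesVanSuijlekom.weilGroundEnergy_mul_le_re f.isWeilTest f.tsupport_subset
  nlinarith

/-- `0 ≤ Re ⟪f, f⟫`. [folklore] -/
private theorem ip_self_re_nonneg (f : WeilCore a) : 0 ≤ (ip f f).re :=
  (integral_nonneg fun _ ↦ by positivity).trans (integral_norm_sq_le_ip_self_re f)

/-- Additivity of the form pairing in the first variable. [cite: Kato1966, VI §1.3 (the pre-Hilbert space `H_𝔥` and its inclusion in `H`), held p0369] -/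
theorem ip_add_left (f₁ f₂ g : WeilCore a) :
    letI := addCommGroup a
    ip (f₁ + f₂) g = ip f₁ g + ip f₂ g := by
  letI := addCommGroup a
  unfold ip
  rw [val_add, weilSesqForm_add_left f₁.isWeilTest f₂.isWeilTest g.isWeilTest]
  have hi : ∫ t, conj ((f₁.val + f₂.val) t) * g.val t =
      (∫ t, conj (f₁.val t) * g.val t) + ∫ t, conj (f₂.val t) * g.val t := by
    rw [← integral_add (integrable_conj_mul f₁.isWeilTest g.isWeilTest)
      (integrable_conj_mul f₂.isWeilTest g.isWeilTest)]
    refine integral_congr_ae (Eventually.of_forall fun t ↦ ?_)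
    simp only [Pi.add_apply, map_add]
    ring
  rw [hi]
  ring

/-- Antilinearity of the form pairing in the first variable. [cite: Kato1966, VI §1.3 (the pre-Hilbert space `H_𝔥` and its inclusion in `H`), held p0369] -/
theorem ip_smul_left (c : ℂ) (f g : WeilCore a) :
    letI := addCommGroup a; letI := module a
    ip (c • f) g = conj c * ip f g := by
  letI := addCommGroup a; letI := module a
  unfold ip
  rw [val_smul, weilSesqForm_const_mul_left c f.isWeilTest g.isWeilTest]
  have hi : ∫ t, conj (c * f.val t) * g.val t = conj c * ∫ t, conj (f.val t) * g.val t := by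
    rw [← integral_const_mul]
    refine integral_congr_ae (Eventually.of_forall fun t ↦ ?_)
    simp only [map_mul]
    ring
  rw [hi]
  ring

/-- Definiteness: `⟪f, f⟫ = 0 ⟹ f = 0` (a continuous function with `∫ |f|² = 0` vanishes). [cite: Kato1966, VI §1.3 (the pre-Hilbert space `H_𝔥` and its inclusion in `H`), held p0369] -/
theorem eq_zero_of_ip_self_eq_zero (f : WeilCore a) (hf : ip f f = 0) :
    letI := addCommGroup a
    f = 0 := by
  have hre := congrArg Complex.re hf
  rw [Complex.zero_re] at hre
  have h := integral_norm_sq_le_ip_self_re f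
  have h0 : 0 ≤ ∫ t, ‖f.val t‖ ^ 2 := integral_nonneg fun _ ↦ by positivity
  have hz : ∫ t, ‖f.val t‖ ^ 2 = 0 := by linarith
  exact val_injective (f.isWeilTest.eq_zero_of_integral_norm_sq_eq_zero hz)

/-- The pre-Hilbert structure of the core (explicit; no instance is declared). [cite: Kato1966, VI §1.3 (the pre-Hilbert space `H_𝔥`), held p0369] -/
abbrev ipCore (a : ℝ) : @InnerProductSpace.Core ℂ (WeilCore a) _ (addCommGroup a) (module a) :=
  letI := addCommGroup a
  letI := module a
  { inner := ip
    conj_inner_symm := conj_ip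
    re_inner_nonneg := ip_self_re_nonneg
    add_left := ip_add_left
    smul_left := fun f g c => ip_smul_left c f g
    definite := eq_zero_of_ip_self_eq_zero }

/-- The form norm structure on the core (explicit; used via `letI`). [cite: Kato1966, VI §1.3 (the norm `‖u‖_𝔥`), held p0369] -/
abbrev normedAddCommGroup (a : ℝ) : NormedAddCommGroup (WeilCore a) :=
  @InnerProductSpace.Core.toNormedAddCommGroup ℂ (WeilCore a) _ (addCommGroup a) (module a)
    (ipCore a)

/-- The form inner-product structure on the core (explicit; used via `letI`). [cite: Kato1966, VI §1.3 (the inner product `(u, v)_𝔥`), held p0369] -/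
abbrev innerProductSpace (a : ℝ) :
    @InnerProductSpace ℂ (WeilCore a) _ (normedAddCommGroup a).toSeminormedAddCommGroup :=
  letI : NormedAddCommGroup (WeilCore a) := normedAddCommGroup a
  @InnerProductSpace.ofCore ℂ (WeilCore a) _ (addCommGroup a) (module a)
    (@InnerProductSpace.Core.toCore ℂ (WeilCore a) _ (addCommGroup a) (module a) (ipCore a))

/-- The inner product, unfolded. [cite: Kato1966, VI §1.3 (the pre-Hilbert space `H_𝔥` and its inclusion in `H`), held p0369] -/
theorem inner_eq_ip (f g : WeilCore a) :
    letI := normedAddCommGroup a; letI := innerProductSpace a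
    ⟪f, g⟫_ℂ = ip f g := rfl

/-- The form norm: `‖f‖² = Re Q(f) + (1 − ε(a)) ‖f‖₂²`. [cite: Kato1966, VI §1.3 eq. (1.30) (`‖u‖_𝔥² = 𝔥[u] + ‖u‖²`), held p0369] -/
theorem norm_sq_eq (f : WeilCore a) :
    letI := normedAddCommGroup a
    ‖f‖ ^ 2 = (weilQuadratic f.val).re + (1 - weilGroundEnergy a) * ∫ t, ‖f.val t‖ ^ 2 := by
  letI := normedAddCommGroup a; letI := innerProductSpace a
  rw [@norm_sq_eq_re_inner ℂ, inner_eq_ip, ← ip_self_re]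
  rfl

/-- The `L²`-norm is dominated by the form norm: `∫ ‖f‖² ≤ ‖f‖²`. [cite: Kato1966, VI §1.3 («`‖u‖ ≤ ‖u‖_𝔥`»), held p0369] -/
theorem integral_norm_sq_le_norm_sq (f : WeilCore a) :
    letI := normedAddCommGroup a
    ∫ t, ‖f.val t‖ ^ 2 ≤ ‖f‖ ^ 2 := by
  rw [norm_sq_eq, ← ip_self_re]
  exact integral_norm_sq_le_ip_self_re f

end WeilCore


/-! ## The ambient Hilbert space `L²([−a, a], dt)` and the inclusion of the core -/

/-- Lebesgue measure restricted to the window `[−a, a]` — the printed `d*u` on `[λ⁻¹, λ]`, `a = log λ`. [cite: ConnesConsaniMoscovici2025, §3.1 p. 8 (`L²([λ⁻¹, λ], d*u)`, `d*u = du/u`)] -/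
abbrev windowMeasure (a : ℝ) : Measure ℝ := volume.restrict (Icc (-a) a)

/-- The Hilbert space `L²([λ⁻¹, λ], d*u) = L²([−a, a], dt)` of (3.23). [cite: ConnesConsaniMoscovici2025, §3.1 p. 8 and §3.2 eq. (3.23), p. 9 (the Hilbert space `L²([λ⁻¹, λ], d*u)`)] -/
abbrev WindowL2 (a : ℝ) : Type := Lp ℂ 2 (windowMeasure a)

namespace WeilCore

variable {a : ℝ}

/-- A core element is square integrable on the window. [cite: ConnesConsaniMoscovici2025, §3.1 p. 8 (`L²([λ⁻¹, λ], d*u)`)] -/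
theorem memLp (f : WeilCore a) : MemLp f.val 2 (windowMeasure a) :=
  f.isWeilTest.1.continuous.memLp_of_hasCompactSupport f.isWeilTest.2

/-- A core function vanishes off the window. [cite: ConnesConsaniMoscovici2025, §3.1 p. 8 (the domain of `QW_λ`: functions on the window `[λ⁻¹, λ]`)] -/
theorem apply_eq_zero_of_notMem (f : WeilCore a) {t : ℝ} (ht : t ∉ Icc (-a) a) : f.val t = 0 :=
  image_eq_zero_of_notMem_tsupport fun h ↦ ht (f.tsupport_subset h)

/-- The inclusion of the core into `L²` of the window, as a linear map. [cite: Kato1966, VI §1.3 (the pre-Hilbert space `H_𝔥` and its inclusion in `H`), held p0369] -/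
def toL2Lin (a : ℝ) :
    letI := addCommGroup a; letI := module a
    WeilCore a →ₗ[ℂ] WindowL2 a :=
  letI := addCommGroup a; letI := module a
  { toFun := fun f => (memLp f).toLp f.val
    map_add' := fun f g => by
      have h := MemLp.toLp_add (memLp f) (memLp g)
      exact h
    map_smul' := fun c f => by
      have h := MemLp.toLp_const_smul c (memLp f)
      exact h }

/-- Unfolding of `toL2Lin`. [cite: Kato1966, VI §1.3 (the pre-Hilbert space `H_𝔥` and its inclusion in `H`), held p0369] -/
theorem toL2Lin_apply (f : WeilCore a) :
    letI := addCommGroup a; letI := module a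
    toL2Lin a f = (memLp f).toLp f.val := rfl

/-- `⟪ι f, ι g⟫_{L²} = ∫ conj f · g`. [cite: Kato1966, VI §1.3 (the pre-Hilbert space `H_𝔥` and its inclusion in `H`), held p0369] -/
theorem inner_toLp_toLp (f g : WeilCore a) :
    ⟪(memLp f).toLp f.val, (memLp g).toLp g.val⟫_ℂ = ∫ t, conj (f.val t) * g.val t := by
  rw [MeasureTheory.L2.inner_def]
  have h : (fun t ↦ ⟪((memLp f).toLp f.val : WindowL2 a) t, ((memLp g).toLp g.val : WindowL2 a) t⟫_ℂ)
      =ᵐ[windowMeasure a] fun t ↦ conj (f.val t) * g.val t := by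
    filter_upwards [(memLp f).coeFn_toLp, (memLp g).coeFn_toLp] with t hf hg
    rw [hf, hg, RCLike.inner_apply']
  rw [integral_congr_ae h]
  exact setIntegral_eq_integral_of_forall_compl_eq_zero fun t ht ↦ by
    rw [g.apply_eq_zero_of_notMem ht, mul_zero]

/-- `‖ι f‖² = ∫ ‖f‖²`. [cite: Kato1966, VI §1.3 (the pre-Hilbert space `H_𝔥` and its inclusion in `H`), held p0369] -/
theorem norm_toLp_sq (f : WeilCore a) : ‖(memLp f).toLp f.val‖ ^ 2 = ∫ t, ‖f.val t‖ ^ 2 := by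
  rw [@norm_sq_eq_re_inner ℂ, inner_toLp_toLp, integral_conj_mul_self]
  rfl

/-- **The inclusion `ι_a : V_a → L²([−a, a])` of the core**, bounded by `‖ι f‖ ≤ ‖f‖_V`. [cite: Kato1966, VI §1.3 («`H_𝔥` … may be considered as a subset of `H`», `‖u‖ ≤ ‖u‖_𝔥`), held p0369] -/
def toL2 (a : ℝ) :
    letI := normedAddCommGroup a; letI := innerProductSpace a
    WeilCore a →L[ℂ] WindowL2 a :=
  letI := normedAddCommGroup a; letI := innerProductSpace a
  (toL2Lin a).mkContinuous 1 fun f ↦ by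
    rw [one_mul, toL2Lin_apply]
    have h : ‖(memLp f).toLp f.val‖ ^ 2 ≤ ‖f‖ ^ 2 := by
      rw [norm_toLp_sq]; exact integral_norm_sq_le_norm_sq f
    exact (pow_le_pow_iff_left₀ (norm_nonneg _) (norm_nonneg _) two_ne_zero).1 h

/-- Unfolding of `toL2`: `ι f` is the `L²` class of `f`. [cite: Kato1966, VI §1.3 (the pre-Hilbert space `H_𝔥` and its inclusion in `H`), held p0369] -/
theorem toL2_apply (f : WeilCore a) :
    letI := normedAddCommGroup a; letI := innerProductSpace a
    toL2 a f = (memLp f).toLp f.val := rfl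

/-- `ι f = f` a.e. on the window. [cite: Kato1966, VI §1.3 (the pre-Hilbert space `H_𝔥` and its inclusion in `H`), held p0369] -/
theorem coeFn_toL2 (f : WeilCore a) :
    letI := normedAddCommGroup a; letI := innerProductSpace a
    (toL2 a f : ℝ → ℂ) =ᵐ[windowMeasure a] f.val :=
  (memLp f).coeFn_toLp

/-- `⟪ι f, ι g⟫ = ∫ conj f · g`. [cite: Kato1966, VI §1.3 (the pre-Hilbert space `H_𝔥` and its inclusion in `H`), held p0369] -/
theorem inner_toL2 (f g : WeilCore a) :
    letI := normedAddCommGroup a; letI := innerProductSpace a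
    ⟪toL2 a f, toL2 a g⟫_ℂ = ∫ t, conj (f.val t) * g.val t :=
  inner_toLp_toLp f g

/-- `‖ι f‖² = ∫ |f|²`. [cite: Kato1966, VI §1.3 (the pre-Hilbert space `H_𝔥` and its inclusion in `H`), held p0369] -/
theorem norm_toL2_sq (f : WeilCore a) :
    letI := normedAddCommGroup a; letI := innerProductSpace a
    ‖toL2 a f‖ ^ 2 = ∫ t, ‖f.val t‖ ^ 2 :=
  norm_toLp_sq f

/-- `‖ι f‖ ≤ ‖f‖_V`. [cite: Kato1966, VI §1.3 («`‖u‖ ≤ ‖u‖_𝔥`»), held p0369] -/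
theorem norm_toL2_le (f : WeilCore a) :
    letI := normedAddCommGroup a; letI := innerProductSpace a
    ‖toL2 a f‖ ≤ ‖f‖ := by
  letI := normedAddCommGroup a; letI := innerProductSpace a
  have h : ‖toL2 a f‖ ^ 2 ≤ ‖f‖ ^ 2 := by rw [norm_toL2_sq]; exact integral_norm_sq_le_norm_sq f
  exact (pow_le_pow_iff_left₀ (norm_nonneg _) (norm_nonneg _) two_ne_zero).1 h

/-- The form in the `(V, ι)` format: `‖f‖_V² − ‖ι f‖² = Re Q(f) − ε(a) ‖f‖₂²`. [cite: Kato1966, VI §2.1 (the form in the `(Q, J)` normalisation `𝔥[u] = ‖u‖_Q² − ‖Ju‖²`), held p0379] -/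
theorem norm_sq_sub_norm_toL2_sq (f : WeilCore a) :
    letI := normedAddCommGroup a; letI := innerProductSpace a
    ‖f‖ ^ 2 - ‖toL2 a f‖ ^ 2 = (weilQuadratic f.val).re - weilGroundEnergy a * ∫ t, ‖f.val t‖ ^ 2 := by
  rw [norm_sq_eq, norm_toL2_sq]; ring

/-- … and its sesquilinear version: `⟪f, g⟫_V − ⟪ι f, ι g⟫ = QW(f, g) − ε(a) ⟪f, g⟫_{L²}`. [cite: Kato1966, VI §2.1 Thm 2.1 (i) eq. (2.1) (`𝔥[u, v] = (u, v)_Q − (Ju, Jv)`), held p0379] -/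
theorem inner_sub_inner_toL2 (f g : WeilCore a) :
    letI := normedAddCommGroup a; letI := innerProductSpace a
    ⟪f, g⟫_ℂ - ⟪toL2 a f, toL2 a g⟫_ℂ =
      weilSesqForm f.val g.val - (weilGroundEnergy a : ℂ) * ∫ t, conj (f.val t) * g.val t := by
  rw [inner_eq_ip, inner_toL2, ip]; push_cast; ring

end WeilCore


/-! ## Closability: the form-norm balls of the core are closed under `L²`-convergence (Prop. 3.3) -/

namespace WeilCore

variable {a : ℝ}

/-- `(f − g).val = f.val − g.val`. [cite: ConnesConsaniMoscovici2025, §3.1 p. 8 (the domain of `QW_λ`: functions on the window `[λ⁻¹, λ]`)] -/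
theorem val_sub (f g : WeilCore a) :
    letI := addCommGroup a
    (f - g).val = f.val - g.val := rfl

/-- `‖ι f − ι g‖² = ∫ ‖f − g‖²`. [cite: Kato1966, VI §1.3 (the pre-Hilbert space `H_𝔥` and its inclusion in `H`), held p0369] -/
theorem norm_toL2_sub_sq (f g : WeilCore a) :
    letI := normedAddCommGroup a; letI := innerProductSpace a
    ‖toL2 a f - toL2 a g‖ ^ 2 = ∫ t, ‖f.val t - g.val t‖ ^ 2 := by
  letI := normedAddCommGroup a; letI := innerProductSpace a
  rw [← map_sub, norm_toL2_sq]
  rfl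

/-- **Lower semicontinuity (CCM25 Prop. 3.3 = `ConnesConsaniMoscovici2025_prop_3_3_holds`) in the
`(V, ι)` format of `ClosableForm.formEmbedding_injective_of_norm_le_of_tendsto`**: if core elements
`u n → f` in `L²` with `‖u n‖_V ≤ C`, then `‖f‖_V ≤ C`. [cite: ConnesConsaniMoscovici2025, §3.1 Prop. 3.3, p. 8 (lower semicontinuity); Kato1966, VI §1.4 Thm 1.16, held p0370] -/
theorem norm_le_of_tendsto (ha : 0 < a) (u : ℕ → WeilCore a) (f : WeilCore a) (C : ℝ)
    (hu : letI := normedAddCommGroup a; letI := innerProductSpace a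
      Tendsto (fun n ↦ toL2 a (u n)) atTop (𝓝 (toL2 a f)))
    (hC : letI := normedAddCommGroup a; ∀ n, ‖u n‖ ≤ C) :
    letI := normedAddCommGroup a
    ‖f‖ ≤ C := by
  letI := normedAddCommGroup a; letI := innerProductSpace a
  have hC0 : 0 ≤ C := (norm_nonneg _).trans (hC 0)
  -- `L²`-convergence of the underlying functions
  have hL2 : Tendsto (fun n ↦ ∫ t, ‖(u n).val t - f.val t‖ ^ 2) atTop (𝓝 0) := by
    have h1 : Tendsto (fun n ↦ ‖toL2 a (u n) - toL2 a f‖) atTop (𝓝 0) :=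
      tendsto_iff_norm_sub_tendsto_zero.1 hu
    have h2 : Tendsto (fun n ↦ ‖toL2 a (u n) - toL2 a f‖ ^ 2) atTop (𝓝 0) := by
      simpa using h1.pow 2
    refine h2.congr fun n ↦ ?_
    rw [norm_toL2_sub_sq]
  -- convergence of the `L²` norms
  have hN : Tendsto (fun n ↦ ∫ t, ‖(u n).val t‖ ^ 2) atTop (𝓝 (∫ t, ‖f.val t‖ ^ 2)) := by
    have h1 : Tendsto (fun n ↦ ‖toL2 a (u n)‖ ^ 2) atTop (𝓝 (‖toL2 a f‖ ^ 2)) :=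
      (hu.norm).pow 2
    simpa only [norm_toL2_sq] using h1
  by_contra hlt
  rw [not_le] at hlt
  set ε₀ := weilGroundEnergy a with hε₀
  set Nf := ∫ t, ‖f.val t‖ ^ 2 with hNf
  set L := C ^ 2 - (1 - ε₀) * Nf with hL
  have hQf : (weilQuadratic f.val).re = ‖f‖ ^ 2 - (1 - ε₀) * Nf := by
    rw [norm_sq_eq]; ring
  have hCf : C ^ 2 < ‖f‖ ^ 2 := by
    have := hC0; nlinarith
  have hLQ : L < (weilQuadratic f.val).re := by rw [hQf, hL]; linarith
  set b := (L + (weilQuadratic f.val).re) / 2 with hb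
  have hLb : L < b := by rw [hb]; linarith
  have hbQ : b < (weilQuadratic f.val).re := by rw [hb]; linarith
  -- lsc: eventually `b < Re Q(u n)`
  have h1 : ∀ᶠ n in atTop, b < (weilQuadratic (u n).val).re :=
    ConnesConsaniMoscovici2025_prop_3_3_holds a ha (fun n ↦ (u n).val) f.val
      (fun n ↦ ⟨(u n).isWeilTest, (u n).tsupport_subset⟩) f.isWeilTest f.tsupport_subset hL2 b hbQ
  -- the bound: `Re Q(u n) ≤ C² − (1 − ε₀) ∫ |u n|² → L < b`
  have h2 : ∀ n, (weilQuadratic (u n).val).re ≤ C ^ 2 - (1 - ε₀) * ∫ t, ‖(u n).val t‖ ^ 2 := by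
    intro n
    have hn : ‖u n‖ ^ 2 ≤ C ^ 2 := pow_le_pow_left₀ (norm_nonneg _) (hC n) 2
    rw [norm_sq_eq] at hn
    linarith
  have h3 : Tendsto (fun n ↦ C ^ 2 - (1 - ε₀) * ∫ t, ‖(u n).val t‖ ^ 2) atTop (𝓝 L) :=
    tendsto_const_nhds.sub (hN.const_mul _)
  have h4 : ∀ᶠ n in atTop, C ^ 2 - (1 - ε₀) * ∫ t, ‖(u n).val t‖ ^ 2 < b :=
    h3.eventually (gt_mem_nhds hLb)
  obtain ⟨n, hn1, hn4⟩ := (h1.and h4).exists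
  exact absurd (hn1.trans_le (h2 n)) (not_lt.2 hn4.le)

/-- **Injectivity of the form-domain embedding `J_a = formEmbedding ι_a`** (the Weil form on the
window is closable: CCM25 Prop. 3.3 via Kato VI Thm 1.17). [cite: ConnesConsaniMoscovici2025, §3.1 Prop. 3.3, p. 8 with §3.2 p. 9 («By Proposition 3.3 the condition (3) is fulfilled», [12, Prop. 10.1] (3)⇒(1) closed); Kato1966, VI §1.4 Thm 1.17, held p0371] -/
theorem formEmbedding_toL2_injective (ha : 0 < a) :
    letI := normedAddCommGroup a; letI := innerProductSpace a
    Function.Injective (formEmbedding (toL2 a)) := by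
  letI := normedAddCommGroup a; letI := innerProductSpace a
  exact formEmbedding_injective_of_norm_le_of_tendsto (toL2 a) (norm_le_of_tendsto ha)

end WeilCore


/-! ## Abstract: sequential compactness on the core ⟹ the form-domain embedding is compact -/

section SeqCompact

open UniformSpace

variable {V : Type*} [NormedAddCommGroup V] [InnerProductSpace ℂ V]
variable {H : Type*} [NormedAddCommGroup H] [InnerProductSpace ℂ H] [CompleteSpace H]

omit [CompleteSpace H] in
/-- Removing the normalisation: if every `V`-bounded, `ι`-NORMALISED sequence of the core has an
`ι`-convergent subsequence, so does every `V`-bounded sequence. [cite: Schmudgen2012, Prop. 10.6 (i) (compactness of the form-domain embedding, sequential form)] -/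
theorem exists_tendsto_subseq_of_normalised (ι : V →L[ℂ] H)
    (h : ∀ (u : ℕ → V) (C : ℝ), (∀ n, ‖u n‖ ≤ C) → (∀ n, ‖ι (u n)‖ = 1) →
      ∃ (y : H) (φ : ℕ → ℕ), StrictMono φ ∧ Tendsto (fun n ↦ ι (u (φ n))) atTop (𝓝 y))
    (u : ℕ → V) (C : ℝ) (hC : ∀ n, ‖u n‖ ≤ C) :
    ∃ (y : H) (φ : ℕ → ℕ), StrictMono φ ∧ Tendsto (fun n ↦ ι (u (φ n))) atTop (𝓝 y) := by
  -- the norms `r n = ‖ι (u n)‖` are bounded: extract a convergent subsequence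
  have hr : ∀ n, ‖ι (u n)‖ ∈ Icc (0 : ℝ) (‖ι‖ * C) := fun n ↦
    ⟨norm_nonneg _, (ι.le_opNorm _).trans (mul_le_mul_of_nonneg_left (hC n) (norm_nonneg _))⟩
  obtain ⟨r, hr_mem, φ₀, hφ₀, hrt⟩ := tendsto_subseq_of_bounded (Metric.isBounded_Icc _ _) hr
  have hrt' : Tendsto (fun n ↦ ‖ι (u (φ₀ n))‖) atTop (𝓝 r) := hrt
  have hr0 : 0 ≤ r := by
    rw [closure_Icc] at hr_mem
    exact hr_mem.1
  rcases hr0.eq_or_lt with hr0 | hrpos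
  · -- `‖ι (u (φ₀ n))‖ → 0`
    refine ⟨0, φ₀, hφ₀, ?_⟩
    rw [tendsto_zero_iff_norm_tendsto_zero]
    rw [← hr0] at hrt'
    exact hrt'
  · -- eventually `‖ι (u (φ₀ n))‖ > r / 2`; normalise
    obtain ⟨N, hN⟩ := (Metric.tendsto_atTop.1 hrt') (r / 2) (half_pos hrpos)
    have hlow : ∀ n, r / 2 < ‖ι (u (φ₀ (n + N)))‖ := fun n ↦ by
      have := hN (n + N) (Nat.le_add_left N n)
      rw [Real.dist_eq, abs_lt] at this
      linarith [this.1]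
    have hne : ∀ n, ‖ι (u (φ₀ (n + N)))‖ ≠ 0 := fun n ↦ ((half_pos hrpos).trans (hlow n)).ne'
    set w : ℕ → V := fun n ↦ ((‖ι (u (φ₀ (n + N)))‖⁻¹ : ℝ) : ℂ) • u (φ₀ (n + N)) with hw
    have hιw : ∀ n, ι (w n) = ((‖ι (u (φ₀ (n + N)))‖⁻¹ : ℝ) : ℂ) • ι (u (φ₀ (n + N))) := fun n ↦ by
      rw [hw, map_smul]
    have hw1 : ∀ n, ‖ι (w n)‖ = 1 := fun n ↦ by
      rw [hιw, norm_smul, Complex.norm_real, Real.norm_of_nonneg (inv_nonneg.2 (norm_nonneg _)),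
        inv_mul_cancel₀ (hne n)]
    have hwC : ∀ n, ‖w n‖ ≤ 2 / r * C := fun n ↦ by
      rw [hw, norm_smul, Complex.norm_real, Real.norm_of_nonneg (inv_nonneg.2 (norm_nonneg _))]
      have h1 : ‖ι (u (φ₀ (n + N)))‖⁻¹ ≤ 2 / r := by
        rw [inv_le_comm₀ ((half_pos hrpos).trans (hlow n)) (by positivity)]
        have := hlow n
        rw [inv_div]; linarith
      have hC0 : 0 ≤ C := (norm_nonneg _).trans (hC 0)
      exact mul_le_mul h1 (hC _) (norm_nonneg _) (by positivity)
    obtain ⟨y, χ, hχ, hy⟩ := h w (2 / r * C) hwC hw1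
    refine ⟨(r : ℂ) • y, fun n ↦ φ₀ (χ n + N), fun m n hmn ↦ hφ₀ (by simpa using hχ hmn), ?_⟩
    -- `ι (u (φ₀ (χ n + N))) = ‖ι (u (φ₀ (χ n + N)))‖ • ι (w (χ n)) → r • y`
    have hscal : Tendsto (fun n ↦ ((‖ι (u (φ₀ (χ n + N)))‖ : ℝ) : ℂ)) atTop (𝓝 (r : ℂ)) := by
      have h1 : Tendsto (fun n ↦ ‖ι (u (φ₀ (χ n + N)))‖) atTop (𝓝 r) :=
        hrt'.comp (tendsto_atTop_mono (fun n ↦ Nat.le_add_right (χ n) N) hχ.tendsto_atTop)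
      exact (Complex.continuous_ofReal.tendsto r).comp h1
    have heq : ∀ n, ι (u (φ₀ (χ n + N))) = ((‖ι (u (φ₀ (χ n + N)))‖ : ℝ) : ℂ) • ι (w (χ n)) := by
      intro n
      rw [hιw, smul_smul, ← Complex.ofReal_mul, mul_inv_cancel₀ (hne (χ n)), Complex.ofReal_one,
        one_smul]
    exact (hscal.smul hy).congr fun n ↦ (heq n).symm

/-- **Sequential compactness on the core ⟹ compact form-domain embedding**: if every `V`-bounded,
`ι`-normalised sequence of the core `V` has an `ι`-convergent subsequence in `H`, then the extension
`J = formEmbedding ι : Completion V → H` is a compact operator (the hypothesis (1) of CCM25 Prop. 3.5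
= Schmüdgen Prop. 10.6 (i), in sequential form). [cite: Schmudgen2012, Prop. 10.6 (i); Kato1966, VI §1.3] -/
theorem isCompactOperator_formEmbedding_of_seq (ι : V →L[ℂ] H)
    (h : ∀ (u : ℕ → V) (C : ℝ), (∀ n, ‖u n‖ ≤ C) → (∀ n, ‖ι (u n)‖ = 1) →
      ∃ (y : H) (φ : ℕ → ℕ), StrictMono φ ∧ Tendsto (fun n ↦ ι (u (φ n))) atTop (𝓝 y)) :
    IsCompactOperator (formEmbedding ι) := by
  set K : Set H := closure (ι '' Metric.closedBall 0 2) with hK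
  -- `K` is sequentially compact, hence compact
  have hKseq : IsSeqCompact K := by
    intro x hx
    have hx' : ∀ n, ∃ v : V, ‖v‖ ≤ 2 ∧ dist (x n) (ι v) < 1 / (n + 1) := fun n ↦ by
      obtain ⟨b, hb, hd⟩ := Metric.mem_closure_iff.1 (hx n) (1 / (n + 1)) Nat.one_div_pos_of_nat
      obtain ⟨v, hv, rfl⟩ := hb
      exact ⟨v, mem_closedBall_zero_iff.1 hv, hd⟩
    choose v hv2 hvd using hx'
    obtain ⟨y, φ, hφ, hy⟩ := exists_tendsto_subseq_of_normalised ι h v 2 hv2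
    have hxy : Tendsto (fun n ↦ x (φ n)) atTop (𝓝 y) := by
      rw [tendsto_iff_dist_tendsto_zero]
      have h0 : Tendsto (fun n ↦ (1 : ℝ) / ((φ n : ℕ) + 1)) atTop (𝓝 0) :=
        (tendsto_one_div_add_atTop_nhds_zero_nat).comp hφ.tendsto_atTop
      have h1 : Tendsto (fun n ↦ dist (ι (v (φ n))) y) atTop (𝓝 0) :=
        (tendsto_iff_dist_tendsto_zero).1 hy
      have h2 : Tendsto (fun n ↦ (1 : ℝ) / ((φ n : ℕ) + 1) + dist (ι (v (φ n))) y) atTop (𝓝 0) := by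
        have := h0.add h1
        rwa [add_zero] at this
      refine squeeze_zero (fun n ↦ dist_nonneg) (fun n ↦ ?_) h2
      exact (dist_triangle _ (ι (v (φ n))) _).trans (add_le_add (hvd (φ n)).le le_rfl)
    refine ⟨y, ?_, φ, hφ, hxy⟩
    exact isClosed_closure.mem_of_tendsto hy
      (Eventually.of_forall fun n ↦ subset_closure ⟨v (φ n), mem_closedBall_zero_iff.2 (hv2 _), rfl⟩)
  have hKc : IsCompact K := hKseq.isCompact
  refine ⟨K, hKc, Filter.mem_of_superset (Metric.ball_mem_nhds 0 one_pos) fun x hx ↦ ?_⟩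
  -- `x` in the unit ball of the completion is a limit of core elements of norm `< 2`
  rw [Set.mem_preimage]
  have hxc : x ∈ closure (Set.range ((↑) : V → Completion V)) := by
    rw [Completion.denseRange_coe.closure_range]; exact Set.mem_univ x
  obtain ⟨s, hs, hsx⟩ := mem_closure_iff_seq_limit.1 hxc
  choose w hw using hs
  have hsw : ∀ n, (w n : Completion V) = s n := hw
  have hnorm : Tendsto (fun n ↦ ‖w n‖) atTop (𝓝 ‖x‖) := by
    have := (continuous_norm.tendsto x).comp hsx
    refine this.congr fun n ↦ ?_
    simp only [Function.comp_apply]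
    rw [← hsw n, Completion.norm_coe]
  have hx1 : ‖x‖ < 2 := by rw [mem_ball_zero_iff] at hx; linarith
  have hev : ∀ᶠ n in atTop, ‖w n‖ ≤ 2 := (hnorm.eventually (gt_mem_nhds hx1)).mono fun n hn ↦ hn.le
  have hJ : Tendsto (fun n ↦ ι (w n)) atTop (𝓝 (formEmbedding ι x)) := by
    have := ((formEmbedding ι).continuous.tendsto x).comp hsx
    refine this.congr fun n ↦ ?_
    simp only [Function.comp_apply]
    rw [← hsw n, formEmbedding_coe]
  exact mem_closure_of_tendsto hJ (hev.mono fun n hn ↦ ⟨w n, mem_closedBall_zero_iff.2 hn, rfl⟩)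

end SeqCompact

/-! ## Compactness of the form-domain embedding (Thm. 3.6 = `ConnesConsaniMoscovici2025_thm_3_6_holds`) -/

/-- `‖toLp F‖² = ∫ ‖F‖² dμ` in `L²(μ)`. [folklore] -/
private theorem norm_toLp_sq_eq_integral {μ : Measure ℝ} {F : ℝ → ℂ} (hF : MemLp F 2 μ) :
    ‖hF.toLp F‖ ^ 2 = ∫ t, ‖F t‖ ^ 2 ∂μ := by
  rw [@norm_sq_eq_re_inner ℂ, MeasureTheory.L2.inner_def]
  have h : (fun t ↦ ⟪(hF.toLp F : Lp ℂ 2 μ) t, (hF.toLp F : Lp ℂ 2 μ) t⟫_ℂ)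
      =ᵐ[μ] fun t ↦ ((‖F t‖ ^ 2 : ℝ) : ℂ) := by
    filter_upwards [hF.coeFn_toLp] with t ht
    rw [ht, RCLike.inner_apply', Complex.conj_mul', Complex.ofReal_pow]
  rw [integral_congr_ae h, integral_complex_ofReal]
  rfl

namespace WeilCore

variable {a : ℝ}

/-- **The sequential compactness of Thm. 3.6 in the `(V, ι)` format**: every `V`-bounded,
`L²`-normalised sequence of the core has an `L²([−a, a])`-convergent subsequence. [cite: ConnesConsaniMoscovici2025, §3.2 Thm. 3.6 and its proof, pp. 9–10] -/
theorem exists_tendsto_subseq (ha : 0 < a) (u : ℕ → WeilCore a) (C : ℝ)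
    (hC : letI := normedAddCommGroup a; ∀ n, ‖u n‖ ≤ C)
    (h1 : letI := normedAddCommGroup a; letI := innerProductSpace a
      ∀ n, ‖toL2 a (u n)‖ = 1) :
    letI := normedAddCommGroup a; letI := innerProductSpace a
    ∃ (y : WindowL2 a) (φ : ℕ → ℕ), StrictMono φ ∧
      Tendsto (fun n ↦ toL2 a (u (φ n))) atTop (𝓝 y) := by
  letI := normedAddCommGroup a; letI := innerProductSpace a
  have hnorm1 : ∀ n, ∫ t, ‖(u n).val t‖ ^ 2 = (1 : ℝ) := fun n ↦ by
    rw [← norm_toL2_sq, h1, one_pow]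
  have hQ : ∀ n, (weilQuadratic (u n).val).re ≤ C ^ 2 + |1 - weilGroundEnergy a| := fun n ↦ by
    have hn : ‖u n‖ ^ 2 ≤ C ^ 2 := pow_le_pow_left₀ (norm_nonneg _) (hC n) 2
    rw [norm_sq_eq, hnorm1, mul_one] at hn
    have := le_abs_self (1 - weilGroundEnergy a)
    have := neg_abs_le (1 - weilGroundEnergy a)
    linarith
  have hbdd : BddAbove (Set.range fun n ↦ (weilQuadratic (u n).val).re) := ⟨_, by
    rintro _ ⟨n, rfl⟩; exact hQ n⟩
  obtain ⟨w, hw, φ, hφ, hconv⟩ := ConnesConsaniMoscovici2025_thm_3_6_holds a ha (fun n ↦ (u n).val)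
    (fun n ↦ ⟨(u n).isWeilTest, (u n).tsupport_subset, hnorm1 n⟩) hbdd
  have hw' : MemLp w 2 (windowMeasure a) := hw.restrict _
  refine ⟨hw'.toLp w, φ, hφ, ?_⟩
  rw [tendsto_iff_norm_sub_tendsto_zero]
  -- `‖ι (u (φ n)) − toLp w‖² = ∫_{[−a,a]} |g (φ n) − w|² ≤ ∫ |g (φ n) − w|² → 0`
  have hsq : ∀ n, ‖toL2 a (u (φ n)) - hw'.toLp w‖ ^ 2 ≤ ∫ t, ‖(u (φ n)).val t - w t‖ ^ 2 := by
    intro n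
    have hgn : MemLp (u (φ n)).val 2 (windowMeasure a) := (u (φ n)).memLp
    have hsub : toL2 a (u (φ n)) - hw'.toLp w = (hgn.sub hw').toLp ((u (φ n)).val - w) := by
      rw [toL2_apply, MemLp.toLp_sub]
    rw [hsub, norm_toLp_sq_eq_integral]
    have hgv : MemLp (u (φ n)).val 2 volume :=
      (u (φ n)).isWeilTest.1.continuous.memLp_of_hasCompactSupport (u (φ n)).isWeilTest.2
    have hint : Integrable (fun t ↦ ‖((u (φ n)).val - w) t‖ ^ 2) volume :=
      (memLp_two_iff_integrable_sq_norm (hgv.sub hw).1).1 (hgv.sub hw)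
    exact setIntegral_le_integral hint (Eventually.of_forall fun t ↦ by positivity)
  have hsq0 : Tendsto (fun n ↦ ‖toL2 a (u (φ n)) - hw'.toLp w‖ ^ 2) atTop (𝓝 0) :=
    squeeze_zero (fun n ↦ by positivity) hsq hconv
  have := (Real.continuous_sqrt.tendsto 0).comp hsq0
  rw [Real.sqrt_zero] at this
  refine this.congr fun n ↦ ?_
  simp only [Function.comp_apply]
  rw [Real.sqrt_sq (norm_nonneg _)]

/-- **Compactness of the form-domain embedding `J_a`** (CCM25 Thm. 3.6 / Prop. 3.5 (1)). [cite: ConnesConsaniMoscovici2025, §3.2 Prop. 3.5 (1) and Thm. 3.6, p. 9] -/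
theorem isCompactOperator_formEmbedding_toL2 (ha : 0 < a) :
    letI := normedAddCommGroup a; letI := innerProductSpace a
    IsCompactOperator (formEmbedding (toL2 a)) := by
  letI := normedAddCommGroup a; letI := innerProductSpace a
  exact isCompactOperator_formEmbedding_of_seq (toL2 a) (exists_tendsto_subseq ha)

end WeilCore


/-! ## Density of the core in `L²([−a, a])` -/

namespace WeilCore

variable {a : ℝ}

/-- `‖toLp (sᶜ.indicator F)‖² = ∫_{sᶜ} ‖F‖²`. [folklore] -/
private theorem norm_toLp_indicator_compl_sq {μ : Measure ℝ} {F : ℝ → ℂ} (hF : MemLp F 2 μ)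
    {s : Set ℝ} (hs : MeasurableSet s) :
    ‖(hF.indicator hs.compl).toLp (sᶜ.indicator F)‖ ^ 2 = ∫ t in sᶜ, ‖F t‖ ^ 2 ∂μ := by
  rw [norm_toLp_sq_eq_integral, ← integral_indicator hs.compl]
  congr 1 with t
  by_cases ht : t ∈ sᶜ
  · rw [indicator_of_mem ht, indicator_of_mem ht]
  · rw [indicator_of_notMem ht, indicator_of_notMem ht, norm_zero, zero_pow two_ne_zero]

/-- Smooth functions compactly supported in the window, cut off by a bump: a core element. [folklore] -/
private theorem isWeilTest_bump_mul (χ : ContDiffBump (0 : ℝ)) {g : ℝ → ℂ} (hg : ContDiff ℝ ∞ g)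
    (hgc : HasCompactSupport g) : IsWeilTest fun t ↦ (χ t : ℂ) * g t :=
  ⟨(Complex.ofRealCLM.contDiff.comp χ.contDiff).mul hg, hgc.mul_left⟩

/-- The cut-off product is supported in the closed ball of the bump's outer radius. [folklore] -/
private theorem tsupport_bump_mul_subset (χ : ContDiffBump (0 : ℝ)) (g : ℝ → ℂ) :
    tsupport (fun t ↦ (χ t : ℂ) * g t) ⊆ Metric.closedBall 0 χ.rOut := by
  refine tsupport_mul_subset_left.trans (closure_minimal (fun t ht ↦ ?_) Metric.isClosed_closedBall)
  have h : χ t ≠ 0 := fun h0 ↦ ht (by simp only [h0, Complex.ofReal_zero])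
  have : t ∈ Function.support χ := h
  rw [χ.support_eq] at this
  exact Metric.ball_subset_closedBall this

/-- **The window test functions are dense in `L²([−a, a])`** (so `J_a` has dense range): truncate to
`[−a + δ, a − δ]`, approximate in `L²(ℝ)` by a smooth compactly supported function (Mathlib
`MemLp.exist_eLpNorm_sub_le`), and cut off by a smooth bump equal to `1` on `[−a + δ, a − δ]` and
supported in `(−a, a)`. [cite: Kato1966, VI §1.4 (densely defined forms), held p0371] -/
theorem denseRange_toL2 (ha : 0 < a) :
    letI := normedAddCommGroup a; letI := innerProductSpace a
    DenseRange (toL2 a) := by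
  letI := normedAddCommGroup a; letI := innerProductSpace a
  refine Metric.denseRange_iff.2 fun F r hr ↦ ?_
  set μ : Measure ℝ := windowMeasure a with hμ
  have hF : MemLp (F : ℝ → ℂ) 2 μ := Lp.memLp F
  have hFint : Integrable (fun t ↦ ‖(F : ℝ → ℂ) t‖ ^ 2) μ := (memLp_two_iff_integrable_sq_norm hF.1).1 hF
  -- Step 1: truncation to `closedBall 0 (a − δ_k)`, `δ_k = a / (k + 2)`
  set T : ℕ → Set ℝ := fun k ↦ (Metric.closedBall (0 : ℝ) (a - a / (k + 2)))ᶜ with hT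
  have hTm : ∀ k, MeasurableSet (T k) := fun k ↦ Metric.isClosed_closedBall.measurableSet.compl
  have hTanti : Antitone T := by
    intro k l hkl
    refine Set.compl_subset_compl.2 (Metric.closedBall_subset_closedBall ?_)
    have h1 : (k : ℝ) + 2 ≤ l + 2 := by exact_mod_cast Nat.add_le_add_right hkl 2
    have h2 : a / (l + 2) ≤ a / (k + 2) := div_le_div_of_nonneg_left ha.le (by positivity) h1
    linarith
  have hlim : Tendsto (fun k ↦ ∫ t in T k, ‖(F : ℝ → ℂ) t‖ ^ 2 ∂μ) atTop (𝓝 0) := by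
    have h := tendsto_setIntegral_of_antitone (μ := μ) (f := fun t ↦ ‖(F : ℝ → ℂ) t‖ ^ 2) hTm hTanti
      ⟨0, hFint.integrableOn⟩
    have hnull : μ (⋂ k, T k) = 0 := by
      rw [hμ, Measure.restrict_apply (MeasurableSet.iInter hTm)]
      have hsub : (⋂ k, T k) ∩ Icc (-a) a ⊆ {a, -a} := by
        rintro x ⟨hx, hxI⟩
        rw [Set.mem_iInter] at hx
        have habs : a ≤ |x| := by
          by_contra hlt
          rw [not_le] at hlt
          obtain ⟨k, hk⟩ := exists_nat_gt (a / (a - |x|))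
          have hk2 : a / (a - |x|) < (k : ℝ) + 2 := by linarith
          have hδ : a / ((k : ℝ) + 2) < a - |x| := by
            rw [div_lt_iff₀ (by positivity)]
            rw [div_lt_iff₀ (by linarith)] at hk2
            linarith
          have hxk := hx k
          simp only [hT, Set.mem_compl_iff, Metric.mem_closedBall, dist_zero_right, Real.norm_eq_abs,
            not_le] at hxk
          linarith
        have hxa : |x| ≤ a := abs_le.2 ⟨hxI.1, hxI.2⟩
        have : |x| = a := le_antisymm hxa habs
        rcases abs_eq ha.le |>.1 this with h | h
        · exact Or.inl h
        · exact Or.inr h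
      exact measure_mono_null hsub (((Set.finite_singleton (-a)).insert a).measure_zero volume)
    rw [setIntegral_measure_zero _ hnull] at h
    exact h
  obtain ⟨k, hk⟩ := ((tendsto_order.1 hlim).2 ((r / 2) ^ 2) (by positivity)).exists
  set δ : ℝ := a / (k + 2) with hδ
  have hδpos : 0 < δ := by positivity
  have hδlt : δ < a := by
    rw [hδ, div_lt_iff₀ (by positivity)]; nlinarith
  set s : Set ℝ := Metric.closedBall (0 : ℝ) (a - δ) with hs
  have hsm : MeasurableSet s := Metric.isClosed_closedBall.measurableSet
  have hsI : s ⊆ Icc (-a) a := by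
    intro x hx
    rw [hs, Metric.mem_closedBall, dist_zero_right, Real.norm_eq_abs, abs_le] at hx
    exact ⟨by linarith [hx.1], by linarith [hx.2]⟩
  set h : ℝ → ℂ := s.indicator (F : ℝ → ℂ) with hh
  have hhμ : MemLp h 2 μ := hF.indicator hsm
  -- `‖F − toLp h‖ < r / 2`
  have hstep1 : dist F (hhμ.toLp h) < r / 2 := by
    have hsub : F - hhμ.toLp h = (hF.indicator hsm.compl).toLp (sᶜ.indicator (F : ℝ → ℂ)) := by
      conv_lhs => rw [← Lp.toLp_coeFn F hF]
      rw [← MemLp.toLp_sub]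
      congr 1
      rw [hh, Set.indicator_compl]
    have hsq : ‖F - hhμ.toLp h‖ ^ 2 < (r / 2) ^ 2 := by
      rw [hsub, norm_toLp_indicator_compl_sq hF hsm]
      exact hk
    rw [dist_eq_norm]
    exact (pow_lt_pow_iff_left₀ (norm_nonneg _) (by positivity) two_ne_zero).1 hsq
  -- Step 2: smooth approximation of `h` in `L²(ℝ)`
  have hhvol : MemLp h 2 (volume : Measure ℝ) := by
    rw [hh, memLp_indicator_iff_restrict hsm]
    exact hF.mono_measure (Measure.restrict_mono hsI le_rfl)
  obtain ⟨g, hgc, hgs, hgη⟩ := hhvol.exist_eLpNorm_sub_le ENNReal.ofNat_ne_top (by norm_num)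
    (half_pos hr)
  -- Step 3: cut-off
  let χ : ContDiffBump (0 : ℝ) := ⟨a - δ, a - δ / 2, by linarith, by linarith⟩
  set g₂ : ℝ → ℂ := fun t ↦ (χ t : ℂ) * g t with hg₂
  have hg₂t : IsWeilTest g₂ := isWeilTest_bump_mul χ hgs hgc
  have hrIn : χ.rIn = a - δ := rfl
  have hrOut : χ.rOut = a - δ / 2 := rfl
  have hg₂s : tsupport g₂ ⊆ Icc (-a) a := by
    refine (tsupport_bump_mul_subset χ g).trans fun x hx ↦ ?_
    rw [Metric.mem_closedBall, dist_zero_right, Real.norm_eq_abs, abs_le, hrOut] at hx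
    exact ⟨by linarith [hx.1], by linarith [hx.2]⟩
  set v : WeilCore a := mk g₂ hg₂t hg₂s with hv
  have hpt : ∀ t, ‖(h - g₂) t‖ ≤ ‖(h - g) t‖ := by
    intro t
    simp only [Pi.sub_apply, hg₂]
    by_cases ht : t ∈ s
    · have h1 : χ t = 1 := χ.one_of_mem_closedBall (by rw [hrIn]; exact ht)
      rw [h1, Complex.ofReal_one, one_mul]
    · have h0 : h t = 0 := by rw [hh, indicator_of_notMem ht]
      rw [h0, zero_sub, zero_sub, norm_neg, norm_neg, norm_mul, Complex.norm_real,
        Real.norm_of_nonneg (χ.nonneg)]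
      exact mul_le_of_le_one_left (norm_nonneg _) χ.le_one
  have hstep3 : dist (hhμ.toLp h) (toL2 a v) ≤ r / 2 := by
    have hg₂μ : MemLp g₂ 2 μ := v.memLp
    rw [dist_eq_norm, toL2_apply, show (memLp v).toLp v.val = hg₂μ.toLp g₂ from rfl,
      ← MemLp.toLp_sub, Lp.norm_toLp]
    refine ENNReal.toReal_le_of_le_ofReal (half_pos hr).le ?_
    calc eLpNorm (h - g₂) 2 μ ≤ eLpNorm (h - g₂) 2 volume := eLpNorm_mono_measure _ Measure.restrict_le_self
      _ ≤ eLpNorm (h - g) 2 volume := eLpNorm_mono hpt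
      _ ≤ ENNReal.ofReal (r / 2) := hgη
  refine ⟨v, ?_⟩
  calc dist F (toL2 a v) ≤ dist F (hhμ.toLp h) + dist (hhμ.toLp h) (toL2 a v) := dist_triangle _ _ _
    _ < r / 2 + r / 2 := add_lt_add_of_lt_of_le hstep1 hstep3
    _ = r := by ring

/-- **The form-domain embedding `J_a` has dense range.** [cite: Kato1966, VI §1.4 (densely defined forms; `J` has dense range), held p0371] -/
theorem denseRange_formEmbedding_toL2 (ha : 0 < a) :
    letI := normedAddCommGroup a; letI := innerProductSpace a
    DenseRange (formEmbedding (toL2 a)) := by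
  letI := normedAddCommGroup a; letI := innerProductSpace a
  exact denseRange_formEmbedding (toL2 a) (denseRange_toL2 ha)

end WeilCore


/-! ## Abstract: real shifts of self-adjoint operators; the form-domain norm -/

section Shift

variable {H : Type*} [NormedAddCommGroup H] [InnerProductSpace ℂ H] [CompleteSpace H]

/-- The shifted operator `T − c` (same domain). [cite: ReedSimonI1980, Thm VIII.3] -/
def shiftPMap (T : H →ₗ.[ℂ] H) (c : ℝ) : H →ₗ.[ℂ] H :=
  { domain := T.domain
    toFun := subSMul T (c : ℂ) }

variable {T : H →ₗ.[ℂ] H}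

omit [CompleteSpace H] in
/-- `dom (T − c) = dom T`. [cite: ReedSimonI1980, Thm VIII.3] -/
theorem shiftPMap_domain (T : H →ₗ.[ℂ] H) (c : ℝ) : (shiftPMap T c).domain = T.domain := rfl

omit [CompleteSpace H] in
/-- Unfolding of `shiftPMap`: `(T − c) x = T x − c x`. [cite: ReedSimonI1980, Thm VIII.3] -/
theorem shiftPMap_apply (T : H →ₗ.[ℂ] H) (c : ℝ) (x : T.domain) :
    (shiftPMap T c x : H) = (T x : H) - (c : ℂ) • (x : H) := rfl

omit [CompleteSpace H] in
/-- `(T − c) − z = T − (z + c)` pointwise. [cite: ReedSimonI1980, Thm VIII.3] -/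
theorem subSMul_shiftPMap_apply (T : H →ₗ.[ℂ] H) (c : ℝ) (z : ℂ) (x : T.domain) :
    subSMul (shiftPMap T c) z x = subSMul T (z + c) x := by
  show (T x : H) - (c : ℂ) • (x : H) - z • (x : H) = (T x : H) - (z + c) • (x : H)
  rw [add_smul]
  abel

/-- `Ran ((T − c) − z) = H` when `Im (z + c) ≠ 0`. [cite: ReedSimonI1980, Thm VIII.3] -/
theorem range_subSMul_shiftPMap_eq_top (hT : IsSelfAdjoint T) (c : ℝ) {z : ℂ} (hz : (z + c).im ≠ 0) :
    LinearMap.range (subSMul (shiftPMap T c) z) = ⊤ := by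
  refine LinearMap.range_eq_top.2 fun y ↦ ?_
  obtain ⟨x, hx⟩ := subSMul_surjective hT hz y
  exact ⟨x, by rw [subSMul_shiftPMap_apply, hx]⟩

/-- **A real shift of a self-adjoint operator is self-adjoint.** [cite: ReedSimonI1980, Thm VIII.3] -/
theorem isSelfAdjoint_shiftPMap (hT : IsSelfAdjoint T) (hd : Dense (T.domain : Set H)) (c : ℝ) :
    IsSelfAdjoint (shiftPMap T c) := by
  have hsymm : (shiftPMap T c).IsSymmetric := by
    rw [LinearPMap.isSymmetric_iff]
    intro x y
    rw [shiftPMap_apply, shiftPMap_apply, inner_sub_left, inner_sub_right, inner_smul_left,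
      inner_smul_right, Complex.conj_ofReal, inner_map_comm_of_isSelfAdjoint hT]
  have h1 : LinearMap.range (subSMul (shiftPMap T c) Complex.I) = ⊤ :=
    range_subSMul_shiftPMap_eq_top hT c (by simp)
  have h2 : LinearMap.range (subSMul (shiftPMap T c) (conj Complex.I)) = ⊤ :=
    range_subSMul_shiftPMap_eq_top hT c (by simp)
  exact isSelfAdjoint_of_isSymmetric_of_range_eq_top hsymm hd h1 h2

/-- The resolvent of the shifted operator: `R_{T − c}(z) = R_T(z + c)`. [cite: ReedSimonI1980, Thm VIII.3] -/
theorem resolvent_shiftPMap (hT : IsSelfAdjoint T) (hd : Dense (T.domain : Set H)) (c : ℝ) {z : ℂ}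
    (hz : z.im ≠ 0) (hz' : (z + c).im ≠ 0) (y : H) :
    resolvent (isSelfAdjoint_shiftPMap hT hd c) hz y = resolvent hT hz' y := by
  set x : T.domain := ⟨resolvent hT hz' y, resolvent_mem_domain hT hz' y⟩ with hx
  have hAx : (shiftPMap T c x : H) - z • (x : H) = y := by
    rw [shiftPMap_apply, ← map_resolvent_sub_smul hT hz' y, add_smul]
    abel
  have h := resolvent_sub_smul (isSelfAdjoint_shiftPMap hT hd c) hz x
  rw [hAx] at h
  rw [h]

/-- Compactness of the resolvent is preserved under real shifts. [cite: ReedSimonI1980, Thm VIII.3] -/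
theorem isCompactOperator_resolvent_shiftPMap (hT : IsSelfAdjoint T) (hd : Dense (T.domain : Set H))
    (c : ℝ) {z : ℂ} (hz : z.im ≠ 0) (hz' : (z + c).im ≠ 0)
    (hK : IsCompactOperator (resolvent hT hz')) :
    IsCompactOperator (resolvent (isSelfAdjoint_shiftPMap hT hd c) hz) := by
  have heq : (resolvent (isSelfAdjoint_shiftPMap hT hd c) hz : H → H) = resolvent hT hz' :=
    funext fun y ↦ resolvent_shiftPMap hT hd c hz hz' y
  rw [heq]
  exact hK

omit [CompleteSpace H] in
/-- Shifting back: `(T − c) − (−c) = T`. [cite: ReedSimonI1980, Thm VIII.3] -/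
theorem shiftPMap_shiftPMap_neg (T : H →ₗ.[ℂ] H) (c : ℝ) : shiftPMap (shiftPMap T c) (-c) = T := by
  refine LinearPMap.ext rfl fun x hx hx' ↦ ?_
  show (T ⟨x, hx'⟩ : H) - (c : ℂ) • x - ((-c : ℝ) : ℂ) • x = (T ⟨x, hx'⟩ : H)
  rw [Complex.ofReal_neg, neg_smul, sub_neg_eq_add, sub_add_cancel]

omit [CompleteSpace H] in
/-- `Re ⟪c • u, u⟫ = c ‖u‖²` for real `c`. [folklore] -/
private theorem re_inner_real_smul_self (c : ℝ) (u : H) : RCLike.re ⟪(c : ℂ) • u, u⟫_ℂ = c * ‖u‖ ^ 2 := by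
  rw [inner_smul_left, Complex.conj_ofReal, ← inner_self_eq_norm_sq (𝕜 := ℂ) u]
  simp only [RCLike.re_to_complex, Complex.re_ofReal_mul]

end Shift

section FormCore

open UniformSpace

variable {V : Type*} [NormedAddCommGroup V] [InnerProductSpace ℂ V]
variable {H : Type*} [NormedAddCommGroup H] [InnerProductSpace ℂ H] [CompleteSpace H]

/-- If `‖ι f‖ ≤ ‖f‖` on the core then `‖J x‖ ≤ ‖x‖` on the completion (`𝔥 ≥ 0`). [cite: Kato1966, VI §1.3–§1.4 (`‖u‖ ≤ ‖u‖_𝔥` on `H_𝔥` and its completion, Thm 1.17), held p0369–p0371] -/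
theorem norm_formEmbedding_le_norm (ι : V →L[ℂ] H) (hι : ∀ f : V, ‖ι f‖ ≤ ‖f‖) (x : Completion V) :
    ‖formEmbedding ι x‖ ≤ ‖x‖ := by
  induction x using Completion.induction_on with
  | hp => exact isClosed_le ((formEmbedding ι).continuous.norm) continuous_norm
  | ih f => rw [formEmbedding_coe, Completion.norm_coe]; exact hι f

end FormCore

open _root_.LinearPMap UniformSpace

/-! ## (3.23) The operator `A_λ` and its spectrum (Prop. 3.5, Thm. 3.6, Cor. 3.7) -/

/-- **(3.23) The self-adjoint operator `A_λ` of the semilocal Weil quadratic form `QW_λ`** in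
`L²([λ⁻¹, λ], d*u) = L²([−a, a], dt)`, `a = log λ`: the Friedrichs operator (Kato's first
representation theorem) of the closable lower-bounded form `QW_λ` given on the core of window test
functions, in the tree's `(Q, J)` format — `Q_a = Completion V_a` (completed form domain),
`J_a = formEmbedding ι_a`, `formOperator J_a` the operator of `𝔥 = Re QW_λ − ε(a)‖·‖²`, shifted back
by `ε(a) = weilGroundEnergy a`.  For `a ≤ 0` (and whenever the hypotheses fail) this is junk; the
theorems assume `0 < a`. [cite: ConnesConsaniMoscovici2025, §3.2 eq. (3.23), p. 9] -/
def weilOperator (a : ℝ) : WindowL2 a →ₗ.[ℂ] WindowL2 a :=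
  letI := WeilCore.normedAddCommGroup a; letI := WeilCore.innerProductSpace a
  shiftPMap (formOperator (formEmbedding (WeilCore.toL2 a))) (-weilGroundEnergy a)

namespace WeilOperator

variable {a : ℝ}

/-- `dom A_λ` is the domain of the Friedrichs operator of the shifted form. [cite: ConnesConsaniMoscovici2025, §3.2 eq. (3.23), p. 9] -/
theorem domain_eq :
    letI := WeilCore.normedAddCommGroup a; letI := WeilCore.innerProductSpace a
    (weilOperator a).domain = (formOperator (formEmbedding (WeilCore.toL2 a))).domain := rfl

/-- `A_λ u = T_𝔥 u + ε(a) u` with `T_𝔥` the Friedrichs operator of `𝔥 = Re QW_λ − ε(a)‖·‖²`. [cite: ConnesConsaniMoscovici2025, §3.2 eq. (3.23), p. 9] -/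
theorem apply_eq (u : (weilOperator a).domain) :
    letI := WeilCore.normedAddCommGroup a; letI := WeilCore.innerProductSpace a
    (weilOperator a u : WindowL2 a) =
      (formOperator (formEmbedding (WeilCore.toL2 a)) u : WindowL2 a) +
        ((weilGroundEnergy a : ℝ) : ℂ) • (u : WindowL2 a) := by
  letI := WeilCore.normedAddCommGroup a; letI := WeilCore.innerProductSpace a
  show (shiftPMap _ _ u : WindowL2 a) = _
  rw [shiftPMap_apply, Complex.ofReal_neg, neg_smul, sub_neg_eq_add]

/-- `‖J x‖ ≤ ‖x‖_Q` on the completed form domain (the form `Re QW_λ − ε(a)‖·‖²` is `≥ 0`). [cite: Kato1966, VI §1.3 («`‖u‖ ≤ ‖u‖_𝔥`»), held p0369] -/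
theorem norm_formEmbedding_le (x : letI := WeilCore.normedAddCommGroup a; Completion (WeilCore a)) :
    letI := WeilCore.normedAddCommGroup a; letI := WeilCore.innerProductSpace a
    ‖formEmbedding (WeilCore.toL2 a) x‖ ≤ ‖x‖ := by
  letI := WeilCore.normedAddCommGroup a; letI := WeilCore.innerProductSpace a
  exact norm_formEmbedding_le_norm _ WeilCore.norm_toL2_le x

/-- **`A_λ` is self-adjoint** (CCM25 p. 9: "there is a canonical lower bounded unbounded selfadjoint
operator `A_λ`"; Kato VI Thm 2.6 = Schmüdgen Thm 10.7 applied to the closable lsc form of Prop. 3.3).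
[cite: ConnesConsaniMoscovici2025, §3.2 eq. (3.23), p. 9] -/
theorem isSelfAdjoint (ha : 0 < a) : IsSelfAdjoint (weilOperator a) := by
  letI := WeilCore.normedAddCommGroup a; letI := WeilCore.innerProductSpace a
  exact isSelfAdjoint_shiftPMap
    (isSelfAdjoint_formOperator (WeilCore.formEmbedding_toL2_injective ha)
      (WeilCore.denseRange_formEmbedding_toL2 ha))
    (dense_formOperator_domain (WeilCore.formEmbedding_toL2_injective ha)
      (WeilCore.denseRange_formEmbedding_toL2 ha)) _

/-- `dom A_λ` is dense. [cite: ConnesConsaniMoscovici2025, §3.2 eq. (3.23), p. 9] -/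
theorem dense_domain (ha : 0 < a) : Dense ((weilOperator a).domain : Set (WindowL2 a)) := by
  letI := WeilCore.normedAddCommGroup a; letI := WeilCore.innerProductSpace a
  exact dense_formOperator_domain (WeilCore.formEmbedding_toL2_injective ha)
    (WeilCore.denseRange_formEmbedding_toL2 ha)

/-- **`A_λ` is lower bounded, by `μ_λ = ε(a) = weilGroundEnergy a`**: `Re ⟪A_λ u, u⟫ ≥ ε(a) ‖u‖²` on
`dom A_λ` (CCM25 p. 9 "By construction the unbounded selfadjoint operator `A_λ` is lower bounded";
Kato VI Thm 2.6 "T and 𝔥 have the same lower bound"). [cite: ConnesConsaniMoscovici2025, §3.2 (after (3.23)), p. 9] -/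
theorem lowerBound (ha : 0 < a) (u : (weilOperator a).domain) :
    weilGroundEnergy a * ‖(u : WindowL2 a)‖ ^ 2 ≤
      RCLike.re ⟪(weilOperator a u : WindowL2 a), (u : WindowL2 a)⟫_ℂ := by
  letI := WeilCore.normedAddCommGroup a; letI := WeilCore.innerProductSpace a
  have h0 := formOperator_lowerBound (WeilCore.formEmbedding_toL2_injective ha)
    (WeilCore.denseRange_formEmbedding_toL2 ha) (γ := 0) (fun x ↦ by
      have := norm_formEmbedding_le (a := a) x
      nlinarith [norm_nonneg (formEmbedding (WeilCore.toL2 a) x)]) u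
  rw [apply_eq, inner_add_left, _root_.map_add, re_inner_real_smul_self]
  rw [zero_mul] at h0
  linarith

/-- **(3.23) on the core: `⟪A_λ f, g⟫ = QW_λ(f, g)`** for window test functions `f, g` with
`f ∈ dom A_λ` (`QW_λ(f, g) = Ψ(f* ∗ g) = weilSesqForm f g`). [cite: ConnesConsaniMoscovici2025, §3.2 eq. (3.23), p. 9] -/
theorem inner_apply_toL2 (ha : 0 < a) (f g : WeilCore a)
    (hf : letI := WeilCore.normedAddCommGroup a; letI := WeilCore.innerProductSpace a
      WeilCore.toL2 a f ∈ (weilOperator a).domain) :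
    letI := WeilCore.normedAddCommGroup a; letI := WeilCore.innerProductSpace a
    ⟪(weilOperator a ⟨WeilCore.toL2 a f, hf⟩ : WindowL2 a), WeilCore.toL2 a g⟫_ℂ =
      weilSesqForm f.val g.val := by
  letI := WeilCore.normedAddCommGroup a; letI := WeilCore.innerProductSpace a
  have h := inner_formOperator_formEmbedding (WeilCore.formEmbedding_toL2_injective ha)
    (WeilCore.denseRange_formEmbedding_toL2 ha) hf g
  rw [apply_eq, inner_add_left, inner_smul_left, Complex.conj_ofReal]
  have hdom : (⟨((⟨WeilCore.toL2 a f, hf⟩ : (weilOperator a).domain) : WindowL2 a), hf⟩ :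
      (formOperator (formEmbedding (WeilCore.toL2 a))).domain) = ⟨WeilCore.toL2 a f, hf⟩ := rfl
  erw [h, WeilCore.inner_sub_inner_toL2, WeilCore.inner_toL2]
  ring

/-- **(3.23), diagonal: `⟪A_λ f, f⟫ = QW_λ(f, f) = Q(f)`** for a window test function `f ∈ dom A_λ`.
[cite: ConnesConsaniMoscovici2025, §3.2 eq. (3.23), p. 9] -/
theorem inner_apply_toL2_self (ha : 0 < a) (f : WeilCore a)
    (hf : letI := WeilCore.normedAddCommGroup a; letI := WeilCore.innerProductSpace a
      WeilCore.toL2 a f ∈ (weilOperator a).domain) :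
    letI := WeilCore.normedAddCommGroup a; letI := WeilCore.innerProductSpace a
    ⟪(weilOperator a ⟨WeilCore.toL2 a f, hf⟩ : WindowL2 a), WeilCore.toL2 a f⟫_ℂ =
      weilQuadratic f.val := by
  rw [inner_apply_toL2 ha f f hf, weilSesqForm_self f.isWeilTest]

/-- **(3.23) on the whole domain (the CLOSED form):** every `u ∈ dom A_λ` is `J_a x` for a (unique)
`x` in the completed form domain `Q_a`, and `Re ⟪A_λ u, u⟫ = ‖x‖_Q² − ‖u‖² + ε(a)‖u‖²` — the closure
of `Re QW_λ` (on the core `‖f‖_Q² − ‖ι f‖² + ε(a)‖ι f‖² = Re Q(f)`, `WeilCore.norm_sq_sub_norm_toL2_sq`).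
[cite: ConnesConsaniMoscovici2025, §3.1 eq. (3.22) and §3.2 eq. (3.23), pp. 8–9] -/
theorem exists_form_eq (ha : 0 < a) (u : (weilOperator a).domain) :
    letI := WeilCore.normedAddCommGroup a; letI := WeilCore.innerProductSpace a
    ∃ x : Completion (WeilCore a), formEmbedding (WeilCore.toL2 a) x = u ∧
      RCLike.re ⟪(weilOperator a u : WindowL2 a), (u : WindowL2 a)⟫_ℂ =
        ‖x‖ ^ 2 - ‖(u : WindowL2 a)‖ ^ 2 + weilGroundEnergy a * ‖(u : WindowL2 a)‖ ^ 2 := by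
  letI := WeilCore.normedAddCommGroup a; letI := WeilCore.innerProductSpace a
  have hJi := WeilCore.formEmbedding_toL2_injective ha
  have hJd := WeilCore.denseRange_formEmbedding_toL2 ha
  set x := ContinuousLinearMap.adjoint (formEmbedding (WeilCore.toL2 a))
    ((formOperator (formEmbedding (WeilCore.toL2 a)) u : WindowL2 a) + u) with hx
  have hxu : formEmbedding (WeilCore.toL2 a) x = u := formOperator_domain_subset_range hJi hJd u
  refine ⟨x, hxu, ?_⟩
  have hmem : formEmbedding (WeilCore.toL2 a) x ∈ (formOperator (formEmbedding (WeilCore.toL2 a))).domain := by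
    rw [hxu]; exact u.2
  have hre := re_inner_formOperator_self hJi hJd hmem
  have hu : (⟨formEmbedding (WeilCore.toL2 a) x, hmem⟩ :
      (formOperator (formEmbedding (WeilCore.toL2 a))).domain) = u := Subtype.ext hxu
  rw [hu, hxu] at hre
  rw [apply_eq, inner_add_left, _root_.map_add, re_inner_real_smul_self]
  have hre' : RCLike.re ⟪(formOperator (formEmbedding (WeilCore.toL2 a)) u : WindowL2 a),
      (u : WindowL2 a)⟫_ℂ = ‖x‖ ^ 2 - ‖(u : WindowL2 a)‖ ^ 2 := hre
  rw [hre']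

/-- **Prop. 3.5 (1) for `A_λ`: the embedding of the form domain `(D[A_λ], ‖·‖_{t_A}) → L²` is COMPACT.**
[cite: ConnesConsaniMoscovici2025, §3.2 Prop. 3.5 (1) and Thm. 3.6, p. 9] -/
theorem isCompactOperator_formEmbedding (ha : 0 < a) :
    letI := WeilCore.normedAddCommGroup a; letI := WeilCore.innerProductSpace a
    IsCompactOperator (formEmbedding (WeilCore.toL2 a)) :=
  WeilCore.isCompactOperator_formEmbedding_toL2 ha

/-- **Prop. 3.5 (2) for `A_λ`: the resolvent `R_z(A_λ)` is COMPACT** (here at every non-real `z`).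
[cite: ConnesConsaniMoscovici2025, §3.2 Prop. 3.5 (2) and Thm. 3.6, p. 9] -/
theorem isCompactOperator_resolvent (ha : 0 < a) {z : ℂ} (hz : z.im ≠ 0) :
    IsCompactOperator (resolvent (isSelfAdjoint ha) hz) := by
  letI := WeilCore.normedAddCommGroup a; letI := WeilCore.innerProductSpace a
  have hJi := WeilCore.formEmbedding_toL2_injective ha
  have hJd := WeilCore.denseRange_formEmbedding_toL2 ha
  have hz' : (z + ((-weilGroundEnergy a : ℝ) : ℂ)).im ≠ 0 := by simpa using hz
  exact isCompactOperator_resolvent_shiftPMap (isSelfAdjoint_formOperator hJi hJd)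
    (dense_formOperator_domain hJi hJd) _ hz hz'
    (isCompactOperator_resolvent_formOperator hJi hJd (isCompactOperator_formEmbedding ha) hz')

/-- **Thm. 3.6 (Prop. 3.5 (4)): `A_λ` has DISCRETE LOWER BOUNDED SPECTRUM** — `L²([−a, a])` has a
Hilbert basis of eigenvectors of `A_λ` with real eigenvalues `μ_i ≥ ε(a) = μ_λ`, `μ_i → +∞` along the
cofinite filter (finitely many in every bounded interval). [cite: ConnesConsaniMoscovici2025, §3.2 Thm. 3.6, p. 9] -/
theorem exists_hilbertBasis_eigenvectors (ha : 0 < a) :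
    ∃ (s : Set (WindowL2 a)) (b : HilbertBasis s ℂ (WindowL2 a)) (μ : s → ℝ),
      ⇑b = ((↑) : s → WindowL2 a) ∧
      (∀ i, ∃ h : (b i : WindowL2 a) ∈ (weilOperator a).domain,
        (weilOperator a ⟨b i, h⟩ : WindowL2 a) = ((μ i : ℝ) : ℂ) • (b i : WindowL2 a)) ∧
      (∀ i, weilGroundEnergy a ≤ μ i) ∧ Tendsto μ cofinite atTop := by
  letI := WeilCore.normedAddCommGroup a; letI := WeilCore.innerProductSpace a
  have hJi := WeilCore.formEmbedding_toL2_injective ha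
  have hJd := WeilCore.denseRange_formEmbedding_toL2 ha
  obtain ⟨s, b, μ, hb, heig, -, htend⟩ :=
    exists_hilbertBasis_eigenvectors_formOperator hJi hJd (isCompactOperator_formEmbedding ha)
  refine ⟨s, b, fun i ↦ μ i + weilGroundEnergy a, hb, fun i ↦ ?_, fun i ↦ ?_,
    tendsto_atTop_add_const_right _ _ htend⟩
  · obtain ⟨h, he⟩ := heig i
    refine ⟨h, ?_⟩
    rw [apply_eq]
    have hcoe : ((⟨(b i : WindowL2 a), h⟩ : (weilOperator a).domain) : WindowL2 a) = b i := rfl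
    erw [he]
    rw [Complex.ofReal_add, add_smul]
  · -- `μ i ≥ 0` from the form lower bound `𝔥 ≥ 0`
    obtain ⟨h, he⟩ := heig i
    have hlb := formOperator_lowerBound hJi hJd (γ := 0) (fun x ↦ by
      have := norm_formEmbedding_le (a := a) x
      nlinarith [norm_nonneg (formEmbedding (WeilCore.toL2 a) x)]) ⟨b i, h⟩
    rw [zero_mul] at hlb
    simp only at hlb
    rw [he, re_inner_real_smul_self] at hlb
    have hn : ‖(b i : WindowL2 a)‖ = 1 := by
      have := b.orthonormal.1 i
      exact this
    rw [hn, one_pow, mul_one] at hlb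
    show weilGroundEnergy a ≤ μ i + weilGroundEnergy a
    linarith

/-- Parseval along a Hilbert basis: `Σ_i |⟪b_i, v⟫|² = ‖v‖²`. [folklore] -/
private theorem hasSum_norm_inner_sq {E : Type*} [NormedAddCommGroup E] [InnerProductSpace ℂ E]
    {ι : Type*} (b : HilbertBasis ι ℂ E) (v : E) :
    HasSum (fun i ↦ ‖⟪b i, v⟫_ℂ‖ ^ 2) (‖v‖ ^ 2) := by
  have h := b.hasSum_inner_mul_inner v v
  have h1 : (fun i ↦ ⟪v, b i⟫_ℂ * ⟪b i, v⟫_ℂ) = fun i ↦ (((‖⟪b i, v⟫_ℂ‖ ^ 2 : ℝ)) : ℂ) := by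
    funext i
    rw [← inner_conj_symm v (b i), Complex.conj_mul', Complex.ofReal_pow]
  rw [h1] at h
  have h2 := Complex.hasSum_re h
  have h3 : (⟪v, v⟫_ℂ).re = ‖v‖ ^ 2 := by
    rw [← RCLike.re_to_complex, inner_self_eq_norm_sq (𝕜 := ℂ)]
  simpa only [Complex.ofReal_re, h3] using h2

/-- **Cor. 3.7 (operator form): the bottom `μ_λ = ε(a)` of the spectrum of `A_λ` is an eigenvalue** —
there is `φ ≠ 0` in `dom A_λ` with `A_λ φ = ε(a) φ`, where `ε(a) = weilGroundEnergy a` is the infimum of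
`Re QW_λ` on the unit sphere of the core (which, by `lowerBound`, is the largest lower bound of `A_λ`).
Proof (CCM25 p. 11 "whose existence is ensured by Theorem 3.6"): in the form eigen-expansion
`𝔥[x] = Σ λ_i |⟪f_i, J x⟫|²` of the compactly embedded form domain
(`Literature.Analysis.OperatorTheory.exists_hilbertBasis_form_hasSum`) the levels `λ_i ≥ 0` tend to
`+∞`, their minimum is attained and equals `inf 𝔥 = 0` on the core sphere, and the corresponding `f_i`
is an eigenvector of the Friedrichs operator (`formOperator_apply_of_form_eigen`).
[cite: ConnesConsaniMoscovici2025, §3.2 Cor. 3.7, p. 11] -/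
theorem exists_eigenvector_weilGroundEnergy (ha : 0 < a) :
    ∃ φ : (weilOperator a).domain, (φ : WindowL2 a) ≠ 0 ∧
      (weilOperator a φ : WindowL2 a) = ((weilGroundEnergy a : ℝ) : ℂ) • (φ : WindowL2 a) := by
  letI := WeilCore.normedAddCommGroup a; letI := WeilCore.innerProductSpace a
  have hJi := WeilCore.formEmbedding_toL2_injective ha
  have hJd := WeilCore.denseRange_formEmbedding_toL2 ha
  have hJc := WeilCore.isCompactOperator_formEmbedding_toL2 ha
  set J := formEmbedding (WeilCore.toL2 a) with hJ
  obtain ⟨s, e, f, lam, hf, -, htend, hsum, hweak⟩ :=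
    Literature.Analysis.OperatorTheory.exists_hilbertBasis_form_hasSum J hJc hJi hJd
  -- each `f i = J (e i)` is an eigenvector of `T` with eigenvalue `lam i ≥ 0`
  have heig : ∀ i, ∃ hmem : J (e i) ∈ (formOperator J).domain,
      (formOperator J ⟨J (e i), hmem⟩ : WindowL2 a) = ((lam i : ℝ) : ℂ) • J (e i) :=
    fun i ↦ formOperator_apply_of_form_eigen hJi hJd (hweak i)
  have hJle : ∀ x, ‖J x‖ ≤ ‖x‖ := fun x ↦ norm_formEmbedding_le (a := a) x
  have hlam0 : ∀ i, 0 ≤ lam i := fun i ↦ by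
    obtain ⟨hmem, he⟩ := heig i
    have hlb := formOperator_lowerBound hJi hJd (γ := 0) (fun x ↦ by
      have := hJle x; nlinarith [norm_nonneg (J x)]) ⟨J (e i), hmem⟩
    rw [zero_mul] at hlb
    simp only at hlb
    rw [he, re_inner_real_smul_self, ← hf i] at hlb
    have hn : ‖(f i : WindowL2 a)‖ = 1 := by
      have := f.orthonormal.1 i
      exact this
    rw [hn, one_pow, mul_one] at hlb
    exact hlb
  -- for every `δ > 0` some level is `< δ` (else `Re Q ≥ (ε + δ)‖·‖²` on the core, contradicting `ε = inf`)
  have hsmall : ∀ δ : ℝ, 0 < δ → ∃ i, lam i < δ := by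
    intro δ hδ
    by_contra hcon
    simp only [not_exists, not_lt] at hcon
    -- `𝔥[x] ≥ δ ‖J x‖²` on `Q`
    have hQ : ∀ x, δ * ‖J x‖ ^ 2 ≤ ‖x‖ ^ 2 - ‖J x‖ ^ 2 := fun x ↦ by
      have h1 := hsum x
      have h2 : HasSum (fun i ↦ δ * ‖⟪f i, J x⟫_ℂ‖ ^ 2) (δ * ‖J x‖ ^ 2) :=
        (hasSum_norm_inner_sq f (J x)).mul_left δ
      exact hasSum_le (fun i ↦ mul_le_mul_of_nonneg_right (hcon i) (by positivity)) h2 h1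
    -- on the core: `Re Q(g) ≥ (ε + δ) ∫ |g|²`
    have hcore : ∀ g : WeilCore a,
        (weilGroundEnergy a + δ) * ∫ t, ‖g.val t‖ ^ 2 ≤ (weilQuadratic g.val).re := fun g ↦ by
      have h1 := hQ (g : Completion (WeilCore a))
      rw [hJ, formEmbedding_coe, Completion.norm_coe, WeilCore.norm_sq_sub_norm_toL2_sq,
        WeilCore.norm_toL2_sq] at h1
      linarith
    -- contradiction with `ε = inf` over the unit sphere
    have hle : weilGroundEnergy a + δ ≤ weilGroundEnergy a := by
      obtain ⟨g₀, hg₀, hg₀s, hg₀n⟩ := exists_isWeilTest_sphere ha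
      refine le_csInf ⟨_, g₀, hg₀, hg₀s, hg₀n, rfl⟩ ?_
      rintro _ ⟨g, hg, hgs, hgn, rfl⟩
      have := hcore (WeilCore.mk g hg hgs)
      rw [WeilCore.val_mk, hgn, mul_one] at this
      exact this
    linarith
  -- the minimum level exists and is `0`
  obtain ⟨i₁, -⟩ := hsmall 1 one_pos
  haveI : Nonempty s := ⟨i₁⟩
  obtain ⟨i₀, hi₀⟩ := htend.exists_forall_le
  have hlam_i₀ : lam i₀ = 0 := by
    refine le_antisymm (le_of_forall_pos_lt_add fun δ hδ ↦ ?_) (hlam0 i₀)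
    obtain ⟨i, hi⟩ := hsmall δ hδ
    linarith [hi₀ i]
  obtain ⟨hmem, he⟩ := heig i₀
  have hne : J (e i₀) ≠ 0 := by rw [← hf i₀]; exact f.orthonormal.ne_zero i₀
  refine ⟨⟨J (e i₀), hmem⟩, hne, ?_⟩
  rw [apply_eq]
  have hcoe : ((⟨J (e i₀), hmem⟩ : (weilOperator a).domain) : WindowL2 a) = J (e i₀) := rfl
  erw [he]
  rw [hlam_i₀, Complex.ofReal_zero, zero_smul, zero_add]

/-- **`A_λ` is CANONICAL (Kato's uniqueness): a self-adjoint operator `S` on `L²([−a, a])` whose domain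
lies in the closed form domain and which represents the closed form `QW_λ` — for `u ∈ dom S` there is
`x ∈ Q_a` with `J_a x = u` and `QW̄_λ(x, y) = ⟪S u, J_a y⟫` for all `y ∈ Q_a`, written in the `(Q, J)`
normalisation `QW̄_λ(x, y) − ε(a)⟪Jx, Jy⟫ = ⟪x, y⟫_Q − ⟪Jx, Jy⟫` — equals `A_λ`.
[cite: ConnesConsaniMoscovici2025, §3.2 p. 9 («a canonical lower bounded unbounded selfadjoint operator»); Kato1966, VI §2.1 Thm 2.1 and Cor 2.4] -/
theorem eq_of_isSelfAdjoint_of_represents (ha : 0 < a) {S : WindowL2 a →ₗ.[ℂ] WindowL2 a}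
    (hS : _root_.IsSelfAdjoint S)
    (hrep : letI := WeilCore.normedAddCommGroup a; letI := WeilCore.innerProductSpace a
      ∀ u : S.domain, ∃ x : Completion (WeilCore a), formEmbedding (WeilCore.toL2 a) x = u ∧
        ∀ y : Completion (WeilCore a),
          ⟪x, y⟫_ℂ - ⟪formEmbedding (WeilCore.toL2 a) x, formEmbedding (WeilCore.toL2 a) y⟫_ℂ =
            ⟪(S u : WindowL2 a) - ((weilGroundEnergy a : ℝ) : ℂ) • (u : WindowL2 a),
              formEmbedding (WeilCore.toL2 a) y⟫_ℂ) :
    S = weilOperator a := by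
  letI := WeilCore.normedAddCommGroup a; letI := WeilCore.innerProductSpace a
  have hJi := WeilCore.formEmbedding_toL2_injective ha
  have hJd := WeilCore.denseRange_formEmbedding_toL2 ha
  -- `S − ε` is self-adjoint and represents `𝔥`; by Kato's uniqueness it is `T`
  have hS' : _root_.IsSelfAdjoint (shiftPMap S (weilGroundEnergy a)) :=
    isSelfAdjoint_shiftPMap hS hS.dense_domain _
  have heq : shiftPMap S (weilGroundEnergy a) = formOperator (formEmbedding (WeilCore.toL2 a)) :=
    eq_formOperator_of_isSelfAdjoint hJi hJd hS' fun u ↦ by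
      obtain ⟨x, hxu, hx⟩ := hrep u
      exact ⟨x, hxu, fun y ↦ by rw [hx y, shiftPMap_apply]⟩
  -- undo the shift
  calc S = shiftPMap (shiftPMap S (weilGroundEnergy a)) (-weilGroundEnergy a) :=
        (shiftPMap_shiftPMap_neg S _).symm
    _ = weilOperator a := by rw [heq]; rfl

end WeilOperator


/-! ## Thm. 3.6, `ℕ`-indexed: `L²([−a, a])` is infinite-dimensional, `μ₀, μ₁, … → +∞` -/

namespace WeilOperator

variable {a : ℝ}

/-- `L²([−a, a])` is infinite-dimensional for `a > 0` (the indicators of the disjoint intervals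
`(−a + a/(n+2), −a + a/(n+1))` are pairwise orthogonal and non-zero). [cite: ConnesConsaniMoscovici2025, §3.2 Thm. 3.6, p. 9 (the spectrum of `A_λ` is an infinite discrete set)] -/
theorem not_finiteDimensional (ha : 0 < a) : ¬ FiniteDimensional ℂ (WindowL2 a) := by
  intro hfin
  set I : ℕ → Set ℝ := fun n ↦ Ioo (-a + a / ((n : ℝ) + 2)) (-a + a / ((n : ℝ) + 1)) with hI
  have hIm : ∀ n, MeasurableSet (I n) := fun n ↦ measurableSet_Ioo
  have hfrac : ∀ n : ℕ, a / ((n : ℝ) + 2) < a / ((n : ℝ) + 1) := fun n ↦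
    div_lt_div_of_pos_left ha (by positivity) (by linarith)
  have hfrac_le : ∀ n : ℕ, a / ((n : ℝ) + 1) ≤ a := fun n ↦ by
    rw [div_le_iff₀ (by positivity)]; nlinarith
  have hIsub : ∀ n, I n ⊆ Icc (-a) a := fun n x hx ↦ by
    simp only [hI, Set.mem_Ioo] at hx
    have h1 : 0 < a / ((n : ℝ) + 2) := by positivity
    exact ⟨by linarith [hx.1], by linarith [hx.2, hfrac_le n]⟩
  have hμI : ∀ n, windowMeasure a (I n) = ENNReal.ofReal (a / ((n : ℝ) + 1) - a / ((n : ℝ) + 2)) := by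
    intro n
    rw [Measure.restrict_apply (hIm n), Set.inter_eq_left.2 (hIsub n), hI]
    simp only
    rw [Real.volume_Ioo]
    congr 1; ring
  have hμI_top : ∀ n, windowMeasure a (I n) ≠ ⊤ := fun n ↦ by rw [hμI n]; exact ENNReal.ofReal_ne_top
  have hμI_pos : ∀ n, windowMeasure a (I n) ≠ 0 := fun n ↦ by
    rw [hμI n]; exact (ENNReal.ofReal_pos.2 (by linarith [hfrac n])).ne'
  set v : ℕ → WindowL2 a := fun n ↦ indicatorConstLp 2 (hIm n) (hμI_top n) (1 : ℂ) with hv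
  -- disjointness of the intervals
  have hdisj : ∀ m n, m < n → I m ∩ I n = ∅ := by
    intro m n hmn
    have hle : a / ((n : ℝ) + 1) ≤ a / ((m : ℝ) + 2) := by
      refine div_le_div_of_nonneg_left ha.le (by positivity) ?_
      have : (m : ℝ) + 1 ≤ n := by exact_mod_cast hmn
      linarith
    ext x
    simp only [hI, Set.mem_inter_iff, Set.mem_Ioo, Set.mem_empty_iff_false, iff_false, not_and, not_lt,
      and_imp]
    intro h1 _ _
    linarith
  have hinner : Pairwise fun m n ↦ ⟪v m, v n⟫_ℂ = 0 := by
    intro m n hmn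
    simp only [hv]
    rw [MeasureTheory.L2.inner_indicatorConstLp_one_indicatorConstLp_one (hIm m) (hIm n) (hμI_top m) (hμI_top n)]
    rcases lt_or_gt_of_ne hmn with h | h
    · rw [hdisj m n h]; simp
    · rw [Set.inter_comm, hdisj n m h]; simp
  have hne : ∀ n, v n ≠ 0 := fun n ↦ by
    rw [← norm_ne_zero_iff, hv]
    simp only
    rw [norm_indicatorConstLp (by norm_num) (by norm_num), norm_one, one_mul]
    have hpos : 0 < (windowMeasure a).real (I n) :=
      ENNReal.toReal_pos (hμI_pos n) (hμI_top n)
    exact (Real.rpow_pos_of_pos hpos _).ne'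
  have hli : LinearIndependent ℂ v := linearIndependent_of_ne_zero_of_inner_eq_zero hne hinner
  exact Module.Finite.not_linearIndependent_of_infinite v hli

/-- **Thm. 3.6, `ℕ`-indexed: the spectrum of `A_λ` is a sequence `μ₀, μ₁, … ≥ ε(a)` of eigenvalues
with `μ_n → +∞`, the eigenvectors forming a Hilbert basis of `L²([λ⁻¹, λ], d*u)`.**
[cite: ConnesConsaniMoscovici2025, §3.2 Thm. 3.6, p. 9] -/
theorem exists_hilbertBasis_nat_eigenvectors (ha : 0 < a) :
    ∃ (b : HilbertBasis ℕ ℂ (WindowL2 a)) (μ : ℕ → ℝ),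
      (∀ n, ∃ h : (b n : WindowL2 a) ∈ (weilOperator a).domain,
        (weilOperator a ⟨b n, h⟩ : WindowL2 a) = ((μ n : ℝ) : ℂ) • (b n : WindowL2 a)) ∧
      (∀ n, weilGroundEnergy a ≤ μ n) ∧ Tendsto μ atTop atTop := by
  letI := WeilCore.normedAddCommGroup a; letI := WeilCore.innerProductSpace a
  have hJi := WeilCore.formEmbedding_toL2_injective ha
  have hJd := WeilCore.denseRange_formEmbedding_toL2 ha
  obtain ⟨b, μ, heig, -, htend⟩ := exists_hilbertBasis_nat_eigenvectors_formOperator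
    (not_finiteDimensional ha) hJi hJd (isCompactOperator_formEmbedding ha)
  refine ⟨b, fun n ↦ μ n + weilGroundEnergy a, fun n ↦ ?_, fun n ↦ ?_,
    tendsto_atTop_add_const_right _ _ htend⟩
  · obtain ⟨h, he⟩ := heig n
    refine ⟨h, ?_⟩
    rw [apply_eq]
    have hcoe : ((⟨(b n : WindowL2 a), h⟩ : (weilOperator a).domain) : WindowL2 a) = b n := rfl
    erw [he]
    rw [Complex.ofReal_add, add_smul]
  · obtain ⟨h, he⟩ := heig n
    have hlb := formOperator_lowerBound hJi hJd (γ := 0) (fun x ↦ by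
      have := norm_formEmbedding_le (a := a) x
      nlinarith [norm_nonneg (formEmbedding (WeilCore.toL2 a) x)]) ⟨b n, h⟩
    rw [zero_mul] at hlb
    simp only at hlb
    rw [he, re_inner_real_smul_self] at hlb
    have hn : ‖(b n : WindowL2 a)‖ = 1 := by
      have := b.orthonormal.1 n
      exact this
    rw [hn, one_pow, mul_one] at hlb
    show weilGroundEnergy a ≤ μ n + weilGroundEnergy a
    linarith

end WeilOperator


/-! ## Ground states (operator-free, `IsWeilGroundState`) are bottom eigenvectors of `A_λ` -/

namespace WeilCore

variable {a : ℝ}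

/-- `L²(ℝ)`-convergence of core elements to `w` gives convergence of their images under `ι_a` to
`w|[−a, a]` in `L²([−a, a])`. [cite: Kato1966, VI §1.3 (the pre-Hilbert space `H_𝔥` and its inclusion in `H`), held p0369] -/
theorem tendsto_toL2_of_integral_tendsto (g : ℕ → WeilCore a) {w : ℝ → ℂ} (hw : MemLp w 2)
    (hconv : Tendsto (fun n ↦ ∫ t, ‖(g n).val t - w t‖ ^ 2) atTop (𝓝 0)) :
    letI := normedAddCommGroup a; letI := innerProductSpace a
    Tendsto (fun n ↦ toL2 a (g n)) atTop (𝓝 ((hw.restrict (Icc (-a) a)).toLp w)) := by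
  letI := normedAddCommGroup a; letI := innerProductSpace a
  have hw' : MemLp w 2 (windowMeasure a) := hw.restrict _
  show Tendsto (fun n ↦ toL2 a (g n)) atTop (𝓝 (hw'.toLp w))
  rw [tendsto_iff_norm_sub_tendsto_zero]
  have hsq : ∀ n, ‖toL2 a (g n) - hw'.toLp w‖ ^ 2 ≤ ∫ t, ‖(g n).val t - w t‖ ^ 2 := by
    intro n
    have hgn : MemLp (g n).val 2 (windowMeasure a) := (g n).memLp
    have hsub : toL2 a (g n) - hw'.toLp w = (hgn.sub hw').toLp ((g n).val - w) := by
      rw [toL2_apply, MemLp.toLp_sub]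
    rw [hsub, norm_toLp_sq_eq_integral]
    have hgv : MemLp (g n).val 2 volume :=
      (g n).isWeilTest.1.continuous.memLp_of_hasCompactSupport (g n).isWeilTest.2
    have hint : Integrable (fun t ↦ ‖((g n).val - w) t‖ ^ 2) volume :=
      (memLp_two_iff_integrable_sq_norm (hgv.sub hw).1).1 (hgv.sub hw)
    exact setIntegral_le_integral hint (Eventually.of_forall fun t ↦ by positivity)
  have hsq0 : Tendsto (fun n ↦ ‖toL2 a (g n) - hw'.toLp w‖ ^ 2) atTop (𝓝 0) :=
    squeeze_zero (fun n ↦ by positivity) hsq hconv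
  have := (Real.continuous_sqrt.tendsto 0).comp hsq0
  rw [Real.sqrt_zero] at this
  refine this.congr fun n ↦ ?_
  simp only [Function.comp_apply]
  rw [Real.sqrt_sq (norm_nonneg _)]

end WeilCore

namespace WeilOperator

variable {a : ℝ}

/-- **Ground states are eigenvectors of `A_λ` for its bottom eigenvalue `ε(a)`.** If `u` is a ground
state of Weil's quadratic form on the window in the operator-free sense of the tree
(`IsWeilGroundState a u`: `u ∈ L²` is the `L²`-limit of an `L²`-normalised sequence of window test
functions `gₙ` with `Re QW(gₙ) → ε(a)`), then `u|[−a, a] ∈ dom A_λ` and `A_λ u = ε(a) u`.  Proof (the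
variational principle, in CCM25's spectral picture): in the eigen-expansion
`QW̄_λ(x) − ε(a)‖Jx‖² = Σ_i λ_i |⟨f_i, Jx⟩|²` (`λ_i ≥ 0`) the values on `gₙ` tend to `0`, so every
Fourier coefficient `⟨f_i, u⟩` with `λ_i > 0` vanishes and `u` lies in the (finite-dimensional) bottom
eigenspace. [cite: ConnesConsaniMoscovici2025, §3.2 Cor. 3.7, p. 11 (the minimal eigenvalue of `A_λ` and its eigenfunctions); ReedSimonIV1978, §XIII.1 Thm XIII.1 (variational characterisation of the bottom of the spectrum)] -/
theorem apply_eq_smul_of_isWeilGroundState {u : ℝ → ℂ} (hu : IsWeilGroundState a u) :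
    ∃ h : (hu.memLp.restrict (Icc (-a) a)).toLp u ∈ (weilOperator a).domain,
      (weilOperator a ⟨(hu.memLp.restrict (Icc (-a) a)).toLp u, h⟩ : WindowL2 a) =
        ((weilGroundEnergy a : ℝ) : ℂ) • (hu.memLp.restrict (Icc (-a) a)).toLp u := by
  have ha : 0 < a := hu.pos
  letI := WeilCore.normedAddCommGroup a; letI := WeilCore.innerProductSpace a
  have hJi := WeilCore.formEmbedding_toL2_injective ha
  have hJd := WeilCore.denseRange_formEmbedding_toL2 ha
  have hJc := WeilCore.isCompactOperator_formEmbedding_toL2 ha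
  set J := formEmbedding (WeilCore.toL2 a) with hJ
  obtain ⟨s, e, f, lam, hf, -, htend, hsum, hweak⟩ :=
    Literature.Analysis.OperatorTheory.exists_hilbertBasis_form_hasSum J hJc hJi hJd
  -- each `f i = J (e i)` is an eigenvector of `T` with eigenvalue `lam i ≥ 0`
  have heig : ∀ i, ∃ hmem : J (e i) ∈ (formOperator J).domain,
      (formOperator J ⟨J (e i), hmem⟩ : WindowL2 a) = ((lam i : ℝ) : ℂ) • J (e i) :=
    fun i ↦ formOperator_apply_of_form_eigen hJi hJd (hweak i)
  have hJle : ∀ x, ‖J x‖ ≤ ‖x‖ := fun x ↦ norm_formEmbedding_le (a := a) x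
  have hlam0 : ∀ i, 0 ≤ lam i := fun i ↦ by
    obtain ⟨hmem, he⟩ := heig i
    have hlb := formOperator_lowerBound hJi hJd (γ := 0) (fun x ↦ by
      have := hJle x; nlinarith [norm_nonneg (J x)]) ⟨J (e i), hmem⟩
    rw [zero_mul] at hlb
    simp only at hlb
    rw [he, re_inner_real_smul_self, ← hf i] at hlb
    have hn : ‖(f i : WindowL2 a)‖ = 1 := by
      have := f.orthonormal.1 i
      exact this
    rw [hn, one_pow, mul_one] at hlb
    exact hlb
  -- the minimising sequence, as core elements, and its `L²([−a, a])`-limit `U = u|[−a,a]`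
  obtain ⟨g, hg, hQ, hconv⟩ := hu.2
  set gc : ℕ → WeilCore a := fun n ↦ WeilCore.mk (g n) (hg n).1 (hg n).2.1 with hgc
  set U : WindowL2 a := (hu.memLp.restrict (Icc (-a) a)).toLp u with hU
  have hval : ∀ n, (gc n).val = g n := fun n ↦ rfl
  have hJg : ∀ n, J (gc n : Completion (WeilCore a)) = WeilCore.toL2 a (gc n) := fun n ↦
    formEmbedding_coe _ _
  have htendU : Tendsto (fun n ↦ J (gc n : Completion (WeilCore a))) atTop (𝓝 U) := by
    have h := WeilCore.tendsto_toL2_of_integral_tendsto gc hu.memLp hconv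
    exact h.congr fun n ↦ (hJg n).symm
  -- the form values `𝔥[gₙ] = Re QW(gₙ) − ε(a)` tend to `0`
  have hq : ∀ n, ‖(gc n : Completion (WeilCore a))‖ ^ 2 - ‖J (gc n : Completion (WeilCore a))‖ ^ 2
      = (weilQuadratic (g n)).re - weilGroundEnergy a := fun n ↦ by
    rw [hJg, Completion.norm_coe, WeilCore.norm_sq_sub_norm_toL2_sq, hval, (hg n).2.2, mul_one]
  have hq0 : Tendsto (fun n ↦ ‖(gc n : Completion (WeilCore a))‖ ^ 2 -
      ‖J (gc n : Completion (WeilCore a))‖ ^ 2) atTop (𝓝 0) := by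
    have h := hQ.sub_const (weilGroundEnergy a)
    rw [sub_self] at h
    exact h.congr fun n ↦ (hq n).symm
  -- the Fourier coefficients of `U` off the bottom level vanish
  have hcoef : ∀ i, lam i ≠ 0 → ⟪(f i : WindowL2 a), U⟫_ℂ = 0 := by
    intro i hi
    have hpos : 0 < lam i := lt_of_le_of_ne (hlam0 i) (Ne.symm hi)
    have hb : ∀ n, ‖⟪(f i : WindowL2 a), J (gc n : Completion (WeilCore a))⟫_ℂ‖ ^ 2 ≤
        (‖(gc n : Completion (WeilCore a))‖ ^ 2 - ‖J (gc n : Completion (WeilCore a))‖ ^ 2) / lam i := by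
      intro n
      rw [le_div_iff₀ hpos]
      have h := le_hasSum (hsum (gc n : Completion (WeilCore a))) i (fun j _ ↦ by
        have := hlam0 j; positivity)
      linarith
    have h1 : Tendsto (fun n ↦ ‖⟪(f i : WindowL2 a), J (gc n : Completion (WeilCore a))⟫_ℂ‖ ^ 2)
        atTop (𝓝 0) := by
      refine squeeze_zero (fun n ↦ by positivity) hb ?_
      have := hq0.div_const (lam i)
      rwa [zero_div] at this
    have h2 : Tendsto (fun n ↦ ⟪(f i : WindowL2 a), J (gc n : Completion (WeilCore a))⟫_ℂ) atTop
        (𝓝 ⟪(f i : WindowL2 a), U⟫_ℂ) := tendsto_const_nhds.inner htendU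
    have h3 := (h2.norm).pow 2
    have h4 := tendsto_nhds_unique h3 h1
    rwa [sq_eq_zero_iff, norm_eq_zero] at h4
  -- the bottom level `{i | lam i = 0}` is finite
  have hF : Set.Finite {i : s | lam i = 0} := by
    have h := htend.eventually (eventually_gt_atTop (0 : ℝ))
    rw [Filter.eventually_cofinite] at h
    exact h.subset fun i (hi : lam i = 0) ↦ by
      show ¬ (0 < lam i)
      rw [hi]; exact lt_irrefl 0
  set F := hF.toFinset with hFdef
  -- `U` is the (finite) sum of its bottom components
  have hrepr : HasSum (fun i ↦ ⟪(f i : WindowL2 a), U⟫_ℂ • (f i : WindowL2 a)) U := by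
    have h := f.hasSum_repr U
    simp_rw [HilbertBasis.repr_apply_apply] at h
    exact h
  have hUsum : U = ∑ i ∈ F, ⟪(f i : WindowL2 a), U⟫_ℂ • (f i : WindowL2 a) := by
    refine hrepr.unique (hasSum_sum_of_ne_finset_zero fun i hi ↦ ?_)
    have hne : lam i ≠ 0 := by
      intro h0; exact hi (by rw [hFdef, Set.Finite.mem_toFinset]; exact h0)
    rw [hcoef i hne, zero_smul]
  -- hence `U ∈ dom T` and `T U = 0`
  have hmemi : ∀ i, (f i : WindowL2 a) ∈ (formOperator J).domain := fun i ↦ by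
    obtain ⟨hmem, -⟩ := heig i
    rw [hf i]; exact hmem
  have hmemU : U ∈ (formOperator J).domain := by
    rw [hUsum]; exact Submodule.sum_mem _ fun i _ ↦ Submodule.smul_mem _ _ (hmemi i)
  have hTi : ∀ i ∈ F, (formOperator J ⟨f i, hmemi i⟩ : WindowL2 a) = 0 := by
    intro i hi
    have h0 : lam i = 0 := by
      rw [hFdef, Set.Finite.mem_toFinset] at hi; exact hi
    obtain ⟨hmem, he⟩ := heig i
    have hsub : (⟨(f i : WindowL2 a), hmemi i⟩ : (formOperator J).domain) = ⟨J (e i), hmem⟩ :=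
      Subtype.ext (hf i)
    rw [hsub, he, h0, Complex.ofReal_zero, zero_smul]
  have hTU : (formOperator J ⟨U, hmemU⟩ : WindowL2 a) = 0 := by
    have hdom : (⟨U, hmemU⟩ : (formOperator J).domain) =
        ∑ i ∈ F, ⟪(f i : WindowL2 a), U⟫_ℂ • (⟨f i, hmemi i⟩ : (formOperator J).domain) := by
      apply Subtype.ext
      rw [Submodule.coe_sum]
      simp only [Submodule.coe_smul]
      exact hUsum
    rw [hdom]
    show (formOperator J).toFun (∑ i ∈ F, ⟪(f i : WindowL2 a), U⟫_ℂ • (⟨f i, hmemi i⟩ :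
      (formOperator J).domain)) = 0
    rw [map_sum]
    refine Finset.sum_eq_zero fun i hi ↦ ?_
    rw [_root_.map_smul]
    have : (formOperator J).toFun ⟨f i, hmemi i⟩ = formOperator J ⟨f i, hmemi i⟩ := rfl
    rw [this, hTi i hi, smul_zero]
  -- conclusion: `A_λ U = T U + ε U = ε U`
  have hdomA : U ∈ (weilOperator a).domain := by rw [domain_eq]; exact hmemU
  refine ⟨hdomA, ?_⟩
  rw [apply_eq]
  have hcoe : ((⟨U, hdomA⟩ : (weilOperator a).domain) : WindowL2 a) = U := rfl
  erw [hTU]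
  rw [zero_add]

/-- A ground state restricted to the window is a UNIT vector of `L²([−a, a])` (so the eigenvector of
`apply_eq_smul_of_isWeilGroundState` is non-zero): `‖u|[−a,a]‖² = ∫_{[−a,a]} |u|² = ∫ |u|² = 1`, a ground
state vanishing a.e. off the window. [cite: ConnesConsaniMoscovici2025, §3.2 Cor. 3.7, p. 11; Bombieri2000Weil, §4 Thm 3 (the minimiser lies in `L²(E)`)] -/
theorem norm_toLp_of_isWeilGroundState {u : ℝ → ℂ} (hu : IsWeilGroundState a u) :
    ‖(hu.memLp.restrict (Icc (-a) a)).toLp u‖ = 1 := by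
  have hsq : ‖(hu.memLp.restrict (Icc (-a) a)).toLp u‖ ^ 2 = 1 := by
    rw [norm_toLp_sq_eq_integral]
    have h1 : ∫ t in Icc (-a) a, ‖u t‖ ^ 2 = ∫ t, ‖u t‖ ^ 2 :=
      setIntegral_eq_integral_of_ae_compl_eq_zero (hu.ae_eq_zero_of_notMem.mono fun t ht hts ↦ by
        rw [ht hts, norm_zero, zero_pow two_ne_zero])
    rw [show (∫ t, ‖u t‖ ^ 2 ∂(windowMeasure a)) = ∫ t in Icc (-a) a, ‖u t‖ ^ 2 from rfl, h1,
      hu.integral_norm_sq]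
  have h0 : 0 ≤ ‖(hu.memLp.restrict (Icc (-a) a)).toLp u‖ := norm_nonneg _
  nlinarith [hsq, h0]

/-- **Corollary**: a ground state yields a non-zero eigenvector of `A_λ` for the eigenvalue `ε(a)` —
the operator-free `IsWeilGroundState` and the bottom eigenspace of CCM25's `A_λ` describe the same
functions. [cite: ConnesConsaniMoscovici2025, §3.2 Cor. 3.7, p. 11] -/
theorem exists_eigenvector_of_isWeilGroundState {u : ℝ → ℂ} (hu : IsWeilGroundState a u) :
    ∃ φ : (weilOperator a).domain, (φ : WindowL2 a) = (hu.memLp.restrict (Icc (-a) a)).toLp u ∧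
      (φ : WindowL2 a) ≠ 0 ∧
      (weilOperator a φ : WindowL2 a) = ((weilGroundEnergy a : ℝ) : ℂ) • (φ : WindowL2 a) := by
  obtain ⟨h, he⟩ := apply_eq_smul_of_isWeilGroundState hu
  refine ⟨⟨_, h⟩, rfl, ?_, he⟩
  rw [← norm_ne_zero_iff, norm_toLp_of_isWeilGroundState hu]
  exact one_ne_zero

end WeilOperator


/-! ## Conversely: unit eigenvectors of `A_λ` for `ε(a)` are ground states -/

namespace WeilOperator

variable {a : ℝ}

/-- **Unit bottom eigenvectors of `A_λ` are ground states.** If `φ ∈ dom A_λ`, `‖φ‖ = 1` and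
`A_λ φ = ε(a) φ`, then `φ` (a representative on the window, extended by `0`) is a ground state of Weil's
quadratic form in the operator-free sense `IsWeilGroundState` of the tree: pick `x ∈ Q_a` with
`J_a x = φ`; then `𝔥[x] = ⟪T φ, φ⟫ = 0`, and core approximants `c_n → x` in `Q_a`, normalised in
`L²`, form a minimising sequence (`Re QW(g_n) = ‖g_n‖_V² − (1 − ε(a)) → ε(a)`) converging to `φ` in
`L²`.  With `apply_eq_smul_of_isWeilGroundState`: the ground states are exactly the unit vectors of
the bottom eigenspace of `A_λ`. [cite: ConnesConsaniMoscovici2025, §3.2 Cor. 3.7, p. 11; ReedSimonIV1978, §XIII.1 Thm XIII.1 (variational characterisation of the bottom of the spectrum)] -/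
theorem exists_isWeilGroundState_of_apply_eq_smul (ha : 0 < a) (φ : (weilOperator a).domain)
    (hφ1 : ‖(φ : WindowL2 a)‖ = 1)
    (he : (weilOperator a φ : WindowL2 a) = ((weilGroundEnergy a : ℝ) : ℂ) • (φ : WindowL2 a)) :
    ∃ u : ℝ → ℂ, IsWeilGroundState a u ∧ (∀ t ∉ Icc (-a) a, u t = 0) ∧
      u =ᵐ[windowMeasure a] ((φ : WindowL2 a) : ℝ → ℂ) := by
  letI := WeilCore.normedAddCommGroup a; letI := WeilCore.innerProductSpace a
  have hJi := WeilCore.formEmbedding_toL2_injective ha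
  have hJd := WeilCore.denseRange_formEmbedding_toL2 ha
  set J := formEmbedding (WeilCore.toL2 a) with hJ
  set ε := weilGroundEnergy a with hε
  -- `T φ = 0`
  have hT0 : (formOperator J φ : WindowL2 a) = 0 := by
    have h := apply_eq φ
    rw [he] at h
    have h2 := eq_sub_of_add_eq h.symm
    rwa [sub_self] at h2
  -- `x ∈ Q_a` with `J x = φ` and `‖x‖_Q = 1`
  set x := ContinuousLinearMap.adjoint J ((formOperator J φ : WindowL2 a) + φ) with hxdef
  have hx : J x = φ := formOperator_domain_subset_range hJi hJd φ
  have hxmem : J x ∈ (formOperator J).domain := by rw [hx]; exact φ.2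
  have hx1 : ‖x‖ = 1 := by
    have h := re_inner_formOperator_self hJi hJd hxmem
    have hsub : (⟨J x, hxmem⟩ : (formOperator J).domain) = φ := Subtype.ext hx
    rw [hsub, hT0, inner_zero_left, _root_.map_zero, hx, hφ1] at h
    have h2 : ‖x‖ ^ 2 = 1 := by linarith
    have h0 : 0 ≤ ‖x‖ := norm_nonneg x
    nlinarith
  -- core approximants `c n → x` in `Q_a`
  have hxcl : x ∈ closure (Set.range ((↑) : WeilCore a → Completion (WeilCore a))) := by
    rw [Completion.denseRange_coe.closure_range]; exact Set.mem_univ x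
  obtain ⟨y, hy, hyx⟩ := mem_closure_iff_seq_limit.mp hxcl
  choose c hc using hy
  have hJc : Tendsto (fun n ↦ WeilCore.toL2 a (c n)) atTop (𝓝 (φ : WindowL2 a)) := by
    have h := (J.continuous.tendsto x).comp hyx
    rw [hx] at h
    refine h.congr fun n ↦ ?_
    simp only [Function.comp_apply]
    rw [← hc n, hJ, formEmbedding_coe]
  have hnc : Tendsto (fun n ↦ ‖c n‖) atTop (𝓝 1) := by
    have h := hyx.norm
    rw [hx1] at h
    refine h.congr fun n ↦ ?_
    rw [← hc n, Completion.norm_coe]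
  have hr : Tendsto (fun n ↦ ‖WeilCore.toL2 a (c n)‖) atTop (𝓝 1) := by
    have h := hJc.norm
    rwa [hφ1] at h
  -- eventually `‖ι c_n‖ > 1/2`; shift and normalise
  obtain ⟨N, hN⟩ := eventually_atTop.mp (hr.eventually (lt_mem_nhds one_half_lt_one))
  set r : ℕ → ℝ := fun n ↦ ‖WeilCore.toL2 a (c (n + N))‖ with hrdef
  have hrpos : ∀ n, 0 < r n := fun n ↦ lt_trans one_half_pos (hN (n + N) (Nat.le_add_left N n))
  have hr' : Tendsto r atTop (𝓝 1) := hr.comp (tendsto_add_atTop_nat N)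
  set g : ℕ → WeilCore a := fun n ↦ (((r n)⁻¹ : ℝ) : ℂ) • c (n + N) with hgdef
  have hgL2 : ∀ n, WeilCore.toL2 a (g n) = (((r n)⁻¹ : ℝ) : ℂ) • WeilCore.toL2 a (c (n + N)) :=
    fun n ↦ map_smul _ _ _
  have hgL2norm : ∀ n, ‖WeilCore.toL2 a (g n)‖ = 1 := fun n ↦ by
    rw [hgL2, norm_smul, Complex.norm_real, Real.norm_of_nonneg (inv_nonneg.2 (hrpos n).le)]
    exact inv_mul_cancel₀ (hrpos n).ne'
  have hgint : ∀ n, ∫ t, ‖(g n).val t‖ ^ 2 = (1 : ℝ) := fun n ↦ by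
    rw [← WeilCore.norm_toL2_sq, hgL2norm, one_pow]
  -- the candidate ground state: `φ` on the window, `0` outside
  set u : ℝ → ℂ := (Icc (-a) a).indicator ((φ : WindowL2 a) : ℝ → ℂ) with hudef
  have hu0 : ∀ t ∉ Icc (-a) a, u t = 0 := fun t ht ↦ Set.indicator_of_notMem ht _
  have huae : u =ᵐ[windowMeasure a] ((φ : WindowL2 a) : ℝ → ℂ) := by
    filter_upwards [ae_restrict_mem (measurableSet_Icc : MeasurableSet (Icc (-a) a))] with t ht
    exact Set.indicator_of_mem ht _
  have huφ : MemLp ((φ : WindowL2 a) : ℝ → ℂ) 2 (windowMeasure a) := Lp.memLp _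
  have hua : MemLp u 2 (windowMeasure a) := huφ.ae_eq huae.symm
  have hu2 : MemLp u 2 (volume : Measure ℝ) := by
    rw [hudef, memLp_indicator_iff_restrict measurableSet_Icc]; exact huφ
  have htoLpu : hua.toLp u = (φ : WindowL2 a) := by
    rw [MemLp.toLp_congr hua huφ huae, Lp.toLp_coeFn]
  refine ⟨u, ⟨hu2, fun n ↦ (g n).val, fun n ↦ ⟨(g n).isWeilTest, (g n).tsupport_subset, hgint n⟩,
    ?_, ?_⟩, hu0, huae⟩
  · -- `Re QW(g_n) = ‖g_n‖_V² − (1 − ε) → 1 − (1 − ε) = ε`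
    have hQ : ∀ n, (weilQuadratic (g n).val).re = ((r n)⁻¹ * ‖c (n + N)‖) ^ 2 - (1 - ε) := by
      intro n
      have h := WeilCore.norm_sq_eq (g n)
      rw [hgint, mul_one] at h
      have hn : ‖g n‖ = (r n)⁻¹ * ‖c (n + N)‖ := by
        show ‖(((r n)⁻¹ : ℝ) : ℂ) • c (n + N)‖ = _
        rw [norm_smul, Complex.norm_real, Real.norm_of_nonneg (inv_nonneg.2 (hrpos n).le)]
      rw [hn] at h
      linarith
    have h1 : Tendsto (fun n ↦ (r n)⁻¹ * ‖c (n + N)‖) atTop (𝓝 1) := by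
      have h := (hr'.inv₀ one_ne_zero).mul (hnc.comp (tendsto_add_atTop_nat N))
      rw [inv_one, one_mul] at h
      exact h
    have h2 : Tendsto (fun n ↦ ((r n)⁻¹ * ‖c (n + N)‖) ^ 2 - (1 - ε)) atTop (𝓝 ε) := by
      have h := (h1.pow 2).sub_const (1 - ε)
      rw [one_pow, show (1 : ℝ) - (1 - ε) = ε by ring] at h
      exact h
    exact h2.congr fun n ↦ (hQ n).symm
  · -- `∫ |g_n − u|² = ‖ι g_n − φ‖² → 0`
    have hid : ∀ n, ∫ t, ‖(g n).val t - u t‖ ^ 2 =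
        ‖WeilCore.toL2 a (g n) - (φ : WindowL2 a)‖ ^ 2 := by
      intro n
      have hvol : ∫ t in Icc (-a) a, ‖(g n).val t - u t‖ ^ 2 = ∫ t, ‖(g n).val t - u t‖ ^ 2 :=
        setIntegral_eq_integral_of_forall_compl_eq_zero fun t ht ↦ by
          rw [(g n).apply_eq_zero_of_notMem ht, hu0 t ht, sub_zero, norm_zero, zero_pow two_ne_zero]
      calc ∫ t, ‖(g n).val t - u t‖ ^ 2 = ∫ t in Icc (-a) a, ‖(g n).val t - u t‖ ^ 2 := hvol.symm
        _ = ∫ t, ‖((g n).val - u) t‖ ^ 2 ∂(windowMeasure a) := rfl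
        _ = ‖WeilCore.toL2 a (g n) - (φ : WindowL2 a)‖ ^ 2 := by
          rw [← htoLpu, WeilCore.toL2_apply, ← MemLp.toLp_sub, norm_toLp_sq_eq_integral]
    have hlim : Tendsto (fun n ↦ WeilCore.toL2 a (g n)) atTop (𝓝 (φ : WindowL2 a)) := by
      have h1 : Tendsto (fun n ↦ (((r n)⁻¹ : ℝ) : ℂ)) atTop (𝓝 1) := by
        have h0 : Tendsto (fun n ↦ (r n)⁻¹) atTop (𝓝 1) := by
          have h := hr'.inv₀ one_ne_zero
          rwa [inv_one] at h
        have h := (Complex.continuous_ofReal.tendsto 1).comp h0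
        rw [Complex.ofReal_one] at h
        exact h
      have h2 := h1.smul (hJc.comp (tendsto_add_atTop_nat N))
      rw [one_smul] at h2
      exact h2.congr fun n ↦ (hgL2 n).symm
    have h3 : Tendsto (fun n ↦ ‖WeilCore.toL2 a (g n) - (φ : WindowL2 a)‖ ^ 2) atTop (𝓝 0) := by
      have h := (tendsto_iff_norm_sub_tendsto_zero.mp hlim).pow 2
      rwa [zero_pow two_ne_zero] at h
    exact h3.congr fun n ↦ (hid n).symm

end WeilOperator

end Literature.NumberTheory.ConnesConsani2025
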